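import Literature.NumberTheory.LFunctions.SelbergDelangeZetaPow
import Literature.NumberTheory.LFunctions.ClassicalPsiErrorTerm
import Literature.Analysis.Complex.KeyholeHankel
import HarnessLib

/-!
# The Selberg–Delange contour argument for the Riesz mean (MV §7.4, proof of Theorem 7.17)

Topic `Literature/NumberTheory/LFunctions`. Everything here is PROVED (definitions with bodies and
theorems; no named facts). This is the analytic engine of the Selberg–Delange law for `z^{Ω(n)}`
(`SelbergDelangeOmega.lean`, `Literature.NumberTheory.LFunctions.MontgomeryVaughan2007_thm_7_18_Omega`),
written for a general Dirichlet series `∑ a(n) n^{-s} = ζ(s)^z G(s)` (`σ > 1`) with `G` holomorphic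
and bounded on a half-plane `σ > σ₁` (`σ₁ < 1`) — the case `G ≡ 1`, `a = d_z` is Montgomery–Vaughan's
Theorem 7.17, the case `G = F(s,z)` of (7.60), `a_z(n) = z^{Ω(n)}` is Theorem 7.18 for `Ω`.

Following MV pp. 177–178 with two bookkeeping changes (Tenenbaum, II.5 §§5.3–5.4): the contour
integral is that of the RIESZ MEAN `A₁(x) = ∑_{n ≤ x} a(n)(x − n)` with the absolutely convergent
kernel `x^{s+1}/(s(s+1))` (tree: `RieszMean.sum_mul_sub_eq_integral_LSeries`), so no truncation of
Perron's formula is needed, and the expansion around the branch point is carried to any order `N`: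

1. `line_integral_eq_keyhole` — Cauchy's theorem on the rectangles `[b, a] × [δ, T]` and
   `[b, a] × [−T, −δ]` (MV's `C₁`, `C₃`): the line `Re s = a` equals the two tails `|t| ≥ T`, the
   keyhole `b − iδ → a − iδ → a + iδ → b + iδ` (`Keyhole.keyhole`, MV's `C₂`), the horizontal sides
   at height `±T` and the left sides `Re s = b`, `δ ≤ |t| ≤ T`;
2. bounds for tails, horizontal and left sides from `ζ(s)^z ≪ (log T)^R` (MV Theorem 6.7, via
   `SelbergDelange.exists_norm_zetaPow_le_far`) and, on `Re s = b`, `|t| ≤ 1`, from the bound near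
   `s = 1`;
3. the keyhole through `Keyhole.norm_keyhole_sub_sum_le` (Taylor expansion of
   `𝒢(s) = exp(z log ζ₁(s)) G(s)/(s(s+1))` at `s = 1`) and Hankel's formula
   (`Keyhole.hankelLoop_sub_le`);
4. **`exists_riesz_expansion`** — with `L = log x`, `a = 1 + 1/L`, `δ = 1/L`, `T = L^κ`,
   `b = 1 − 2c̄/log(T + 3)`: for every `R ≤ N` there are `C, x₀` such that for all data and all
   `x ≥ x₀`,
   `‖A₁(x) − x² Σ_{k<N} (k!)⁻¹ 𝒢⁽ᵏ⁾(1) Γ(z − k)⁻¹ (log x)^{z−1−k}‖ ≤ C x² (log x)^{Re z − 1 − N}`.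

## References

* [MontgomeryVaughan2007] H. L. Montgomery, R. C. Vaughan, *Multiplicative Number Theory I*,
  CUP 2007, §7.4, proof of Theorem 7.17 (pp. 177–178), Theorem 6.7, §5.1 (5.19).
* [Tenenbaum2015] G. Tenenbaum, *Introduction to analytic and probabilistic number theory*, 3rd
  ed., AMS GSM 163, II.5 §§5.2–5.4 (Theorem II.5.2 and its proof).
-/

noncomputable section

open Complex Set MeasureTheory Filter Topology intervalIntegral Metric
open scoped Real Nat Interval
open Literature.Analysis.Complex Literature.Analysis.Complex.Keyhole

namespace Literature.NumberTheory.LFunctions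

namespace SelbergDelange

open ClassicalPsiData (kernel Phi norm_Phi_eq norm_kernel_le_inv_sq norm_kernel_le_four_div
  differentiableAt_Phi)

/-! ### Cauchy's theorem: from the line `Re s = a` to the keyhole contour -/

/-- **The contour of MV p. 178, rectangular**: if `Φ` is holomorphic on the closed rectangles
`[b, a] × [δ, T]` and `[b, a] × [−T, −δ]` and integrable on the line `Re s = a`, then
`i∫_ℝ Φ(a + it) dt = i·(tails |t| ≥ T) + keyhole Φ b a δ + (∫_b^a Φ(u + iT) − ∫_b^a Φ(u − iT))
  + i(∫_{−T}^{−δ} Φ(b + it) + ∫_δ^T Φ(b + it))`. [cite: MontgomeryVaughan2007, §7.4 p. 178] -/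
theorem line_integral_eq_keyhole {Φ : ℂ → ℂ} {a b δ T : ℝ} (hba : b ≤ a) (hδT : δ ≤ T) (hint : Integrable fun t : ℝ ↦ Φ (a + t * I))
    (hup : DifferentiableOn ℂ Φ (Icc b a ×ℂ Icc δ T))
    (hdown : DifferentiableOn ℂ Φ (Icc b a ×ℂ Icc (-T) (-δ))) :
    I * ∫ t : ℝ, Φ (a + t * I) =
      I * ((∫ t in Iic (-T), Φ (a + t * I)) + ∫ t in Ioi T, Φ (a + t * I)) +
      keyhole Φ b a δ +
      ((∫ u in b..a, Φ (u + T * I)) - ∫ u in b..a, Φ (u + (-T) * I)) +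
      I * ((∫ t in (-T)..(-δ), Φ (b + t * I)) + ∫ t in δ..T, Φ (b + t * I)) := by
  -- split the line
  have hs1 := intervalIntegral.integral_Iic_add_Ioi (b := -T) hint.integrableOn hint.integrableOn
  have hs2 := intervalIntegral.integral_interval_add_Ioi (a := -T) (b := T) hint.integrableOn
    hint.integrableOn
  have hii : ∀ p q : ℝ, IntervalIntegrable (fun t : ℝ ↦ Φ (a + t * I)) volume p q := fun p q ↦
    hint.intervalIntegrable
  have hs3 := intervalIntegral.integral_add_adjacent_intervals (hii (-T) (-δ)) (hii (-δ) δ)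
  have hs4 := intervalIntegral.integral_add_adjacent_intervals (hii (-T) δ) (hii δ T)
  -- Cauchy–Goursat on the two rectangles
  have Hup := Complex.integral_boundary_rect_eq_zero_of_differentiableOn Φ ⟨b, δ⟩ ⟨a, T⟩
    (by simpa [uIcc_of_le hba, uIcc_of_le hδT] using hup)
  have Hdown := Complex.integral_boundary_rect_eq_zero_of_differentiableOn Φ ⟨b, -T⟩ ⟨a, -δ⟩
    (by simpa [uIcc_of_le hba, uIcc_of_le (show -T ≤ -δ by linarith)] using hdown)
  dsimp only at Hup Hdown
  simp only [smul_eq_mul] at Hup Hdown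
  rw [← hs1, ← hs2, ← hs4, ← hs3]
  unfold keyhole
  have e1 : ∀ u : ℝ, Φ ((u : ℂ) + ((-δ : ℝ) : ℂ) * I) = Φ ((u : ℂ) + (-δ : ℂ) * I) := fun u ↦ by
    push_cast; ring_nf
  simp only [ofReal_neg] at *
  linear_combination Hup + Hdown

/-! ### The data of the engine -/

/-- **Hypotheses of the Selberg–Delange contour argument** for coefficients `a`, exponent `z` and
smooth factor `G`: `‖z‖ ≤ R`; `G` holomorphic with `‖G‖ ≤ B` on `σ > σ₁`; `∑ a(n) n^{-s}` converges
absolutely for `σ > 1` and equals `ζ(s)^z G(s)` there (`ζ(s)^z = zetaPow z s`); and the majorant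
bound `∑ ‖a(n)‖ n^{-σ} ≤ B (σ − 1)^{−R}` for `1 < σ ≤ 2`. Model: `a_z(n) = z^{Ω(n)}`, `G = F(s, z)`
of (7.60) (`SelbergDelangeOmegaEulerProduct.lean`); `a = d_z`, `G = 1` (Theorem 7.17).
[cite: MontgomeryVaughan2007, §7.4 Theorems 7.17–7.18] -/
structure RieszData (R σ₁ B : ℝ) (z : ℂ) (a : ℕ → ℂ) (G : ℂ → ℂ) : Prop where
  /-- `‖z‖ ≤ R`. -/
  norm_le : ‖z‖ ≤ R
  /-- `G` is holomorphic on `σ > σ₁`. -/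
  differentiableOn : DifferentiableOn ℂ G {s : ℂ | σ₁ < s.re}
  /-- `‖G s‖ ≤ B` on `σ > σ₁`. -/
  norm_G_le : ∀ s : ℂ, σ₁ < s.re → ‖G s‖ ≤ B
  /-- `∑ a(n) n^{-s}` converges absolutely for `σ > 1`. -/
  summable : ∀ σ : ℝ, 1 < σ → LSeriesSummable a σ
  /-- `∑ a(n) n^{-s} = ζ(s)^z G(s)` for `σ > 1`. -/
  LSeries_eq : ∀ s : ℂ, 1 < s.re → LSeries a s = zetaPow z s * G s
  /-- `∑ ‖a(n)‖ n^{-σ} ≤ B/(σ − 1)^R` for `1 < σ ≤ 2`. -/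
  majorant : ∀ σ : ℝ, 1 < σ → σ ≤ 2 → ∑' n, ‖LSeries.term a σ n‖ ≤ B / (σ - 1) ^ R

/-- The smooth factor at the branch point:
`𝒢(s) = exp(z log ζ₁(s)) G(s)/(s(s+1))`, so that the contour integrand is `(s − 1)^{−z} 𝒢(s) x^{1+s}`.
[cite: MontgomeryVaughan2007, §7.4 p. 178] -/
def smoothPart (z : ℂ) (G : ℂ → ℂ) (s : ℂ) : ℂ := exp (z * logZeta₁ s) * G s * kernel s

/-- The contour integrand `Φ(s) = x^{1+s} ζ(s)^z G(s)/(s(s+1))`. [cite: MontgomeryVaughan2007, §7.4 p. 178] -/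
def integrand (z : ℂ) (G : ℂ → ℂ) (x : ℝ) : ℂ → ℂ := Phi (fun s ↦ zetaPow z s * G s) x

/-- `Φ(s) = (s − 1)^{−z} 𝒢(s) x^{1+s}`. [folklore] -/
theorem integrand_eq (z : ℂ) (G : ℂ → ℂ) (x : ℝ) (s : ℂ) :
    integrand z G x s = (s - 1) ^ (-z) * smoothPart z G s * (x : ℂ) ^ (1 + s) := by
  simp only [integrand, Phi, smoothPart, zetaPow]
  ring

/-- The Taylor coefficients `(k!)⁻¹ 𝒢⁽ᵏ⁾(1)` of the smooth factor. [cite: MontgomeryVaughan2007, §7.4 p. 178] -/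
def coeff (z : ℂ) (G : ℂ → ℂ) (k : ℕ) : ℂ := (k ! : ℂ)⁻¹ * iteratedDeriv k (smoothPart z G) 1

/-! ### The geometry of the contour -/

/-- The abscissa of the left sides, `b(T) = 1 − 2c̄/log(T + 3)` (`c̄ = zfrConst`).
[cite: MontgomeryVaughan2007, §7.4 p. 178 ("put b = 1 − c/log T")] -/
def leftAbscissa (T : ℝ) : ℝ := 1 - 2 * zfrConst / Real.log (T + 3)

/-- `1 − b(T) = 2c̄/log(T+3) > 0`. [folklore] -/
theorem one_sub_leftAbscissa {T : ℝ} (hT : 0 ≤ T) :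
    1 - leftAbscissa T = 2 * zfrConst / Real.log (T + 3) ∧ 0 < 2 * zfrConst / Real.log (T + 3) := by
  refine ⟨by rw [leftAbscissa]; ring, div_pos (by linarith [zfrConst_pos]) (Real.log_pos (by linarith))⟩

/-- `b(T) < 1`. [folklore] -/
theorem leftAbscissa_lt_one {T : ℝ} (hT : 0 ≤ T) : leftAbscissa T < 1 := by
  have := (one_sub_leftAbscissa hT).2; rw [← (one_sub_leftAbscissa hT).1] at this; linarith

/-- `b(T) ≥ 1 − zfrWidth 1 / 2` for `T ≥ 1` (so the box bounds near `s = 1` apply), and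
`b(T) > 1/2`. [folklore] -/
theorem leftAbscissa_ge {T : ℝ} (hT : 1 ≤ T) :
    1 - zfrWidth 1 / 2 ≤ leftAbscissa T ∧ 1 / 2 < leftAbscissa T := by
  have hc := zfrConst_pos
  have hw : zfrWidth 1 / 2 = 2 * zfrConst / Real.log 4 := by
    rw [zfrWidth, abs_one]; norm_num; ring
  have hlog4 : Real.log 4 ≤ Real.log (T + 3) := Real.log_le_log (by norm_num) (by linarith)
  have hlog4pos : 0 < Real.log 4 := Real.log_pos (by norm_num)
  have h1 : 2 * zfrConst / Real.log (T + 3) ≤ 2 * zfrConst / Real.log 4 :=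
    div_le_div_of_nonneg_left (by linarith) hlog4pos hlog4
  have hw1 := zfrWidth_lt_half 1
  refine ⟨?_, ?_⟩
  · rw [hw, leftAbscissa]; linarith
  · rw [leftAbscissa]
    have : 2 * zfrConst / Real.log 4 < 1 / 4 := by rw [← hw]; linarith
    linarith

/-- Points with `b(T) ≤ Re s` and `|Im s| ≤ T + 1` (`T ≥ 1`) lie in the region `Ω` (indeed
`2c̄/log(T+3) < 4c̄/log(T+4)` since `(T+4) < (T+3)²`). [folklore] -/
theorem mem_zfrRegion_of_leftAbscissa_le {T : ℝ} (hT : 1 ≤ T) {s : ℂ} (hre : leftAbscissa T ≤ s.re)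
    (him : |s.im| ≤ T + 1) : s ∈ zfrRegion := by
  refine mem_zfrRegion_of_le him ?_
  have hc := zfrConst_pos
  have hl3 : 0 < Real.log (T + 3) := Real.log_pos (by linarith)
  have hl4 : 0 < Real.log (T + 1 + 3) := Real.log_pos (by linarith)
  have hlt : Real.log (T + 1 + 3) < 2 * Real.log (T + 3) := by
    have h2 : Real.log ((T + 3) ^ 2) = 2 * Real.log (T + 3) := by
      rw [Real.log_pow]; norm_num
    rw [← h2]
    exact Real.log_lt_log (by linarith) (by nlinarith)
  have key : 2 * zfrConst / Real.log (T + 3) < 4 * zfrConst / Real.log (T + 1 + 3) := by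
    rw [div_lt_div_iff₀ hl3 hl4]; nlinarith
  rw [leftAbscissa] at hre
  linarith

/-! ### The smooth factor near `s = 1` -/

/-- The radius `ρ(σ₁) = min(1 − σ₁, zfrWidth 1/2)` of a disc around `1` on which `𝒢` is
holomorphic. [folklore] -/
def rho (σ₁ : ℝ) : ℝ := min (1 - σ₁) (zfrWidth 1 / 2)

/-- `0 < ρ` for `σ₁ < 1`, and `ρ ≤ zfrWidth 1 / 2 < 1/4`. [folklore] -/
theorem rho_pos {σ₁ : ℝ} (hσ₁ : σ₁ < 1) : 0 < rho σ₁ ∧ rho σ₁ ≤ zfrWidth 1 / 2 ∧ rho σ₁ < 1 / 4 := by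
  have hw := zfrWidth_pos 1
  have hw2 := zfrWidth_lt_half 1
  refine ⟨lt_min (by linarith) (by linarith), min_le_right _ _, ?_⟩
  exact (min_le_right _ _).trans_lt (by linarith)

/-- Points of `ball 1 ρ` are in the box `|t| ≤ 1`, `1 − zfrWidth 1/2 ≤ σ ≤ 2`, in `Ω`, have
`σ > σ₁`, `σ > 1/2`, and avoid `0, −1`. [folklore] -/
theorem ball_rho_props {σ₁ : ℝ} (hσ₁ : σ₁ < 1) {s : ℂ} (hs : s ∈ ball (1 : ℂ) (rho σ₁)) :
    |s.im| ≤ 1 ∧ 1 - zfrWidth 1 / 2 ≤ s.re ∧ s.re ≤ 2 ∧ σ₁ < s.re ∧ 1 / 2 < s.re ∧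
      s ∈ zfrRegion ∧ s ≠ 0 ∧ s + 1 ≠ 0 := by
  obtain ⟨hρ, hρw, hρ4⟩ := rho_pos hσ₁
  rw [mem_ball, dist_eq_norm] at hs
  have hre : |s.re - 1| < rho σ₁ := by
    have := abs_re_le_norm (s - 1); simp at this; linarith
  have him : |s.im| < rho σ₁ := by
    have := abs_im_le_norm (s - 1); simp at this; linarith
  have hre1 := (abs_lt.1 hre).1
  have hre2 := (abs_lt.1 hre).2
  have h1 : |s.im| ≤ 1 := by linarith
  have h2 : 1 - zfrWidth 1 / 2 ≤ s.re := by linarith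
  have h3 : s.re ≤ 2 := by linarith
  have hρle : rho σ₁ ≤ 1 - σ₁ := min_le_left _ _
  have h4 : σ₁ < s.re := by linarith
  have h5 : 1 / 2 < s.re := by linarith
  refine ⟨h1, h2, h3, h4, h5, mem_zfrRegion_of_box h1 h2 h3, ?_, ?_⟩
  · intro h; rw [h] at h5; simp at h5; linarith
  · intro h; have := congrArg Complex.re h; simp at this; linarith

/-- `‖1/(s(s+1))‖ ≤ 2` for `Re s ≥ 1/2`. [folklore] -/
theorem norm_kernel_le_two {s : ℂ} (hs : 1 / 2 ≤ s.re) : ‖kernel s‖ ≤ 2 := by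
  have h1 : 1 / 2 ≤ ‖s‖ := hs.trans (re_le_norm s)
  have h2 : 3 / 2 ≤ ‖s + 1‖ := by
    have := re_le_norm (s + 1); simp at this; linarith
  rw [ClassicalPsiData.kernel, norm_div, norm_one, norm_mul]
  calc 1 / (‖s‖ * ‖s + 1‖) ≤ 1 / (1 / 2 * (3 / 2)) :=
        one_div_le_one_div_of_le (by norm_num) (mul_le_mul h1 h2 (by norm_num) (norm_nonneg _))
    _ ≤ 2 := by norm_num

/-- **`𝒢` is holomorphic on `ball 1 ρ`.** [folklore] -/
theorem differentiableOn_smoothPart {R σ₁ B : ℝ} {z : ℂ} {a : ℕ → ℂ} {G : ℂ → ℂ}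
    (h : RieszData R σ₁ B z a G) (hσ₁ : σ₁ < 1) :
    DifferentiableOn ℂ (smoothPart z G) (ball 1 (rho σ₁)) := by
  intro s hs
  obtain ⟨-, -, -, h4, h5, h6, h7, h8⟩ := ball_rho_props hσ₁ hs
  have hL : DifferentiableAt ℂ logZeta₁ s :=
    differentiableOn_logZeta₁.differentiableAt (isOpen_zfrRegion.mem_nhds h6)
  have hG : DifferentiableAt ℂ G s :=
    h.differentiableOn.differentiableAt ((isOpen_lt continuous_const continuous_re).mem_nhds h4)
  have hK : DifferentiableAt ℂ kernel s := by
    unfold ClassicalPsiData.kernel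
    exact (differentiableAt_const _).div (differentiableAt_id.mul (differentiableAt_id.add_const 1))
      (mul_ne_zero h7 h8)
  exact (((hL.const_mul z).cexp.mul hG).mul hK).differentiableWithinAt

/-- **`𝒢` is bounded on `ball 1 ρ`, uniformly in `‖z‖ ≤ R`**: `‖𝒢(s)‖ ≤ 2 C_near(R) B`.
[folklore] -/
theorem norm_smoothPart_le {R σ₁ B : ℝ} {z : ℂ} {a : ℕ → ℂ} {G : ℂ → ℂ}
    (h : RieszData R σ₁ B z a G) (hσ₁ : σ₁ < 1) {Cn : ℝ}
    (hCn : ∀ z s : ℂ, ‖z‖ ≤ R → |s.im| ≤ 1 → 1 - zfrWidth 1 / 2 ≤ s.re → s.re ≤ 2 →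
      ‖exp (z * logZeta₁ s)‖ ≤ Cn) {s : ℂ} (hs : s ∈ ball (1 : ℂ) (rho σ₁)) :
    ‖smoothPart z G s‖ ≤ Cn * B * 2 := by
  obtain ⟨h1, h2, h3, h4, h5, -, -, -⟩ := ball_rho_props hσ₁ hs
  have hB : 0 ≤ B := (norm_nonneg _).trans (h.norm_G_le s h4)
  have hCn0 : 0 ≤ Cn := (norm_nonneg _).trans (hCn z s h.norm_le h1 h2 h3)
  rw [smoothPart, norm_mul, norm_mul]
  exact mul_le_mul (mul_le_mul (hCn z s h.norm_le h1 h2 h3) (h.norm_G_le s h4) (norm_nonneg _) hCn0)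
    (norm_kernel_le_two h5.le) (norm_nonneg _) (by positivity)

/-- The smooth factor at the branch point: `𝒢(1) = G(1)/2`. [folklore] -/
theorem smoothPart_one (z : ℂ) (G : ℂ → ℂ) : smoothPart z G 1 = G 1 / 2 := by
  rw [smoothPart, exp_mul_logZeta₁_one, ClassicalPsiData.kernel]
  norm_num
  ring

/-- The leading coefficient: `c₀ = G(1)/2`. [folklore] -/
theorem coeff_zero (z : ℂ) (G : ℂ → ℂ) : coeff z G 0 = G 1 / 2 := by
  simp [coeff, smoothPart_one]

/-! ### Holomorphy and integrability of the integrand -/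

/-- `Φ` is holomorphic at points of `Ω` off the real axis with `Re s > σ₁`, `Re s > 0`. [folklore] -/
theorem differentiableAt_integrand {R σ₁ B : ℝ} {z : ℂ} {a : ℕ → ℂ} {G : ℂ → ℂ}
    (h : RieszData R σ₁ B z a G) {x : ℝ} (hx : 0 < x) {s : ℂ} (hs : s ∈ zfrRegion) (him : s.im ≠ 0)
    (hσ : σ₁ < s.re) (h0 : 0 < s.re) : DifferentiableAt ℂ (integrand z G x) s := by
  have h1 : DifferentiableAt ℂ (zetaPow z) s :=
    differentiableAt_zetaPow z (mem_zfrSlitRegion_of_im_ne_zero hs him)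
  have h2 : DifferentiableAt ℂ G s :=
    h.differentiableOn.differentiableAt ((isOpen_lt continuous_const continuous_re).mem_nhds hσ)
  exact differentiableAt_Phi hx (h1.mul h2) h0

/-- `Φ` is holomorphic on the closed rectangles `[b(T), a] × [δ, T]` and `[b(T), a] × [−T, −δ]`
(`0 < δ`, `T ≥ 1`, `b(T) > σ₁`). [cite: MontgomeryVaughan2007, §7.4 p. 178] -/
theorem differentiableOn_integrand_rect {R σ₁ B : ℝ} {z : ℂ} {a : ℕ → ℂ} {G : ℂ → ℂ}
    (h : RieszData R σ₁ B z a G) {x : ℝ} (hx : 0 < x) {aa δ T : ℝ} (hT : 1 ≤ T) (hδ : 0 < δ)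
    (hσ₁ : σ₁ < leftAbscissa T) {c d : ℝ} (hcd : (δ ≤ c ∧ d ≤ T) ∨ (-T ≤ c ∧ d ≤ -δ)) :
    DifferentiableOn ℂ (integrand z G x) (Icc (leftAbscissa T) aa ×ℂ Icc c d) := by
  intro s hs
  obtain ⟨⟨hre1, -⟩, him1, him2⟩ := hs
  have hb := (leftAbscissa_ge hT).2
  have himT : |s.im| ≤ T + 1 := by
    rcases hcd with ⟨h1, h2⟩ | ⟨h1, h2⟩ <;> (rw [abs_le]; constructor <;> linarith)
  have him0 : s.im ≠ 0 := by
    rcases hcd with ⟨h1, h2⟩ | ⟨h1, h2⟩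
    · intro h0; linarith
    · intro h0; linarith
  exact (differentiableAt_integrand h hx (mem_zfrRegion_of_leftAbscissa_le hT hre1 himT) him0
    (hσ₁.trans_le hre1) (by linarith)).differentiableWithinAt

/-- On the line `Re s = a > 1` the integrand is the Perron integrand of `∑ a(n) n^{-s}`. [folklore] -/
theorem integrand_line_eq {R σ₁ B : ℝ} {z : ℂ} {a : ℕ → ℂ} {G : ℂ → ℂ}
    (h : RieszData R σ₁ B z a G) (x : ℝ) {aa : ℝ} (haa : 1 < aa) (t : ℝ) :
    integrand z G x (aa + t * I) =
      (x : ℂ) ^ (1 + (aa + t * I)) * LSeries a (aa + t * I) * kernel (aa + t * I) := by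
  rw [integrand, Phi, h.LSeries_eq _ (by simpa using haa)]

/-- `‖L(a, s)‖ ≤ ∑ ‖a(n)‖ n^{-σ}` on `Re s = σ`. [folklore] -/
theorem norm_LSeries_le_tsum (a : ℕ → ℂ) {s : ℂ} (ha : LSeriesSummable a (s.re : ℂ)) :
    ‖LSeries a s‖ ≤ ∑' n : ℕ, ‖LSeries.term a (s.re : ℂ) n‖ := by
  have hS : Summable fun n ↦ ‖LSeries.term a (s.re : ℂ) n‖ := ha.norm
  have heq : ∀ n, ‖LSeries.term a s n‖ = ‖LSeries.term a (s.re : ℂ) n‖ := fun n ↦ by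
    rw [LSeries.norm_term_eq, LSeries.norm_term_eq, ofReal_re]
  have h1 : Summable fun n ↦ ‖LSeries.term a s n‖ := hS.congr fun n ↦ (heq n).symm
  rw [LSeries]
  calc ‖∑' n, LSeries.term a s n‖ ≤ ∑' n, ‖LSeries.term a s n‖ := norm_tsum_le_tsum_norm h1
    _ = ∑' n : ℕ, ‖LSeries.term a (s.re : ℂ) n‖ := tsum_congr heq

/-- The integrand is integrable on the line `Re s = a > 1`. [folklore] -/
theorem integrable_integrand_line {R σ₁ B : ℝ} {z : ℂ} {a : ℕ → ℂ} {G : ℂ → ℂ}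
    (h : RieszData R σ₁ B z a G) {x : ℝ} (hx : 0 < x) {aa : ℝ} (haa : 1 < aa) :
    Integrable fun t : ℝ ↦ integrand z G x (aa + t * I) := by
  have := ClassicalPsiData.integrable_cpow_mul_LSeries_mul_kernel a hx (by linarith)
    (h.summable aa haa)
  exact this.congr (Eventually.of_forall fun t ↦ (integrand_line_eq h x haa t).symm)

/-! ### Bounds on the line `Re s = a`: the tails `|t| ≥ T` -/

/-- On the line: `‖Φ(a + it)‖ ≤ x^{1+a} S_a / t²`, `S_a = ∑ ‖a(n)‖n^{-a}`, `t ≠ 0`. [folklore] -/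
theorem norm_integrand_line_le {R σ₁ B : ℝ} {z : ℂ} {a : ℕ → ℂ} {G : ℂ → ℂ}
    (h : RieszData R σ₁ B z a G) {x : ℝ} (hx : 0 < x) {aa : ℝ} (haa : 1 < aa) {t : ℝ} (ht : t ≠ 0) :
    ‖integrand z G x (aa + t * I)‖ ≤
      x ^ (1 + aa) * (∑' n : ℕ, ‖LSeries.term a (aa : ℂ) n‖) / t ^ 2 := by
  rw [integrand_line_eq h x haa, norm_mul, norm_mul, norm_cpow_eq_rpow_re_of_pos hx]
  have hre : (1 + ((aa : ℂ) + t * I)).re = 1 + aa := by simp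
  rw [hre]
  have hL := norm_LSeries_le_tsum a (s := (aa : ℂ) + t * I) (by simpa using h.summable aa haa)
  have hL' : ‖LSeries a (aa + t * I)‖ ≤ ∑' n : ℕ, ‖LSeries.term a (aa : ℂ) n‖ := by simpa using hL
  have hK : ‖kernel ((aa : ℂ) + t * I)‖ ≤ 1 / t ^ 2 := by
    have := norm_kernel_le_inv_sq (s := (aa : ℂ) + t * I) (by simpa using ht)
    simpa using this
  have h0 : 0 ≤ ∑' n : ℕ, ‖LSeries.term a (aa : ℂ) n‖ := tsum_nonneg fun n ↦ norm_nonneg _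
  calc x ^ (1 + aa) * ‖LSeries a (aa + t * I)‖ * ‖kernel ((aa : ℂ) + t * I)‖
      ≤ x ^ (1 + aa) * (∑' n : ℕ, ‖LSeries.term a (aa : ℂ) n‖) * (1 / t ^ 2) :=
        mul_le_mul (mul_le_mul_of_nonneg_left hL' (by positivity)) hK (norm_nonneg _) (by positivity)
    _ = _ := by ring

/-- **The two tails**: `‖∫_{|t| ≥ T} Φ(a + it)‖ ≤ x^{1+a} S_a / T` each (`T > 0`).
[cite: MontgomeryVaughan2007, §7.4 p. 177] -/
theorem norm_integral_tails_le {R σ₁ B : ℝ} {z : ℂ} {a : ℕ → ℂ} {G : ℂ → ℂ}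
    (h : RieszData R σ₁ B z a G) {x : ℝ} (hx : 0 < x) {aa : ℝ} (haa : 1 < aa) {T : ℝ} (hT : 0 < T) :
    ‖∫ t in Ioi T, integrand z G x (aa + t * I)‖ ≤
        x ^ (1 + aa) * (∑' n : ℕ, ‖LSeries.term a (aa : ℂ) n‖) / T ∧
      ‖∫ t in Iic (-T), integrand z G x (aa + t * I)‖ ≤
        x ^ (1 + aa) * (∑' n : ℕ, ‖LSeries.term a (aa : ℂ) n‖) / T := by
  set S : ℝ := ∑' n : ℕ, ‖LSeries.term a (aa : ℂ) n‖ with hS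
  have hS0 : 0 ≤ S := tsum_nonneg fun n ↦ norm_nonneg _
  set g : ℝ → ℝ := fun t ↦ x ^ (1 + aa) * S * t ^ (-(2 : ℝ)) with hg
  have hgi : IntegrableOn g (Ioi T) :=
    (integrableOn_Ioi_rpow_of_lt (by norm_num : (-(2 : ℝ)) < -1) hT).const_mul _
  have hval : ∫ t in Ioi T, g t = x ^ (1 + aa) * S / T := by
    rw [hg, MeasureTheory.integral_const_mul, integral_Ioi_rpow_of_lt (by norm_num) hT]
    have : (-(2 : ℝ)) + 1 = -1 := by norm_num
    rw [this, Real.rpow_neg_one]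
    field_simp
  have hpt : ∀ t : ℝ, T < |t| → ‖integrand z G x (aa + t * I)‖ ≤ g |t| := by
    intro t ht
    have ht0 : t ≠ 0 := fun h0 ↦ by rw [h0, abs_zero] at ht; linarith
    have := norm_integrand_line_le h hx haa ht0
    rw [hg]
    simp only
    rwa [Real.rpow_neg (abs_nonneg t), Real.rpow_two, sq_abs, ← div_eq_mul_inv]
  constructor
  · have hbound : ∀ᵐ t : ℝ ∂(volume.restrict (Ioi T)), ‖integrand z G x (aa + t * I)‖ ≤ g t := by
      refine (ae_restrict_iff' measurableSet_Ioi).2 (Eventually.of_forall fun t (ht : T < t) ↦ ?_)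
      have := hpt t (by rwa [abs_of_pos (hT.trans ht)])
      rwa [abs_of_pos (hT.trans ht)] at this
    exact (norm_integral_le_of_norm_le hgi hbound).trans (le_of_eq hval)
  · rw [← integral_comp_neg_Ioi]
    have hbound : ∀ᵐ t : ℝ ∂(volume.restrict (Ioi T)),
        ‖integrand z G x (aa + ((-t : ℝ) : ℂ) * I)‖ ≤ g t := by
      refine (ae_restrict_iff' measurableSet_Ioi).2 (Eventually.of_forall fun t (ht : T < t) ↦ ?_)
      have := hpt (-t) (by rwa [abs_neg, abs_of_pos (hT.trans ht)])
      rwa [abs_neg, abs_of_pos (hT.trans ht)] at this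
    exact (norm_integral_le_of_norm_le hgi hbound).trans (le_of_eq hval)

/-! ### Bounds on the horizontal sides and on the left sides far from `1` -/

/-- **The horizontal sides** `[b, a] × {±T}`: with `‖ζ(s)^z‖ ≤ Cf log(|t|+3)^R` for `|t| ≥ 1`,
`‖∫_b^a Φ(u ± iT) du‖ ≤ (a − b) x^{1+a} Cf B (log(T+3))^R / T²` (`T ≥ 1`, `b = b(T) > σ₁`, `a ≤ 2`).
[cite: MontgomeryVaughan2007, §7.4 p. 178] -/
theorem norm_integral_horizontal_le {R σ₁ B : ℝ} {z : ℂ} {a : ℕ → ℂ} {G : ℂ → ℂ}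
    (h : RieszData R σ₁ B z a G) {x : ℝ} (hx : 1 ≤ x) {aa T : ℝ} (hT : 1 ≤ T)
    (hσ₁ : σ₁ < leftAbscissa T) (hba : leftAbscissa T ≤ aa) {Cf : ℝ}
    (hCf : ∀ z s : ℂ, ‖z‖ ≤ R → s ∈ zfrRegion → 1 ≤ |s.im| →
      ‖zetaPow z s‖ ≤ Cf * Real.log (|s.im| + 3) ^ R)
    {T' : ℝ} (hT' : |T'| = T) :
    ‖∫ u in (leftAbscissa T)..aa, integrand z G x (u + T' * I)‖ ≤
      (aa - leftAbscissa T) * (x ^ (1 + aa) * (Cf * Real.log (T + 3) ^ R) * B / T ^ 2) := by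
  have hx0 : 0 < x := by linarith
  have hT'0 : T' ≠ 0 := by rintro rfl; simp at hT'; linarith
  have hb := (leftAbscissa_ge hT).2
  have hbd : ∀ u ∈ Ι (leftAbscissa T) aa, ‖integrand z G x (u + T' * I)‖ ≤
      x ^ (1 + aa) * (Cf * Real.log (T + 3) ^ R) * B / T ^ 2 := by
    intro u hu
    rw [uIoc_of_le hba] at hu
    have him : ((u : ℂ) + T' * I).im = T' := by simp
    have hre : ((u : ℂ) + T' * I).re = u := by simp
    have hmem : ((u : ℂ) + T' * I) ∈ zfrRegion :=
      mem_zfrRegion_of_leftAbscissa_le hT (by rw [hre]; exact hu.1.le) (by rw [him, hT']; linarith)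
    have hZ : ‖zetaPow z (u + T' * I)‖ ≤ Cf * Real.log (T + 3) ^ R := by
      have := hCf z _ h.norm_le hmem (by rw [him, hT']; exact hT)
      rwa [him, hT'] at this
    have hG : ‖G (u + T' * I)‖ ≤ B := h.norm_G_le _ (by rw [hre]; linarith [hu.1])
    have hK : ‖kernel ((u : ℂ) + T' * I)‖ ≤ 1 / T ^ 2 := by
      have := norm_kernel_le_inv_sq (s := (u : ℂ) + T' * I) (by rw [him]; exact hT'0)
      rwa [him, ← sq_abs, hT'] at this
    have hxu : x ^ (1 + u) ≤ x ^ (1 + aa) := Real.rpow_le_rpow_of_exponent_le hx (by linarith [hu.2])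
    have hCf0 : 0 ≤ Cf * Real.log (T + 3) ^ R := (norm_nonneg _).trans hZ
    have hB : 0 ≤ B := (norm_nonneg _).trans hG
    rw [integrand, norm_Phi_eq _ hx0, hre, norm_mul]
    calc x ^ (1 + u) * (‖zetaPow z (u + T' * I)‖ * ‖G (u + T' * I)‖) * ‖kernel ((u : ℂ) + T' * I)‖
        ≤ x ^ (1 + aa) * ((Cf * Real.log (T + 3) ^ R) * B) * (1 / T ^ 2) :=
          mul_le_mul (mul_le_mul hxu (mul_le_mul hZ hG (norm_nonneg _) hCf0) (by positivity)
            (by positivity)) hK (norm_nonneg _) (mul_nonneg (by positivity) (mul_nonneg hCf0 hB))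
      _ = _ := by ring
  have := intervalIntegral.norm_integral_le_of_norm_le_const hbd
  rw [abs_of_nonneg (sub_nonneg.2 hba)] at this
  linarith [this]

/-- **The left sides far from `1`**, `Re s = b(T)`, `1 ≤ |t| ≤ T`:
`‖∫ Φ(b + it) dt‖ ≤ 4π x^{1+b} Cf B (log(T+3))^R` over `[1, T]` and over `[−T, −1]`.
[cite: MontgomeryVaughan2007, §7.4 p. 178] -/
theorem norm_integral_left_far_le {R σ₁ B : ℝ} {z : ℂ} {a : ℕ → ℂ} {G : ℂ → ℂ}
    (h : RieszData R σ₁ B z a G) (hR : 0 ≤ R) {x : ℝ} (hx : 1 ≤ x) {T : ℝ} (hT : 1 ≤ T)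
    (hσ₁ : σ₁ < leftAbscissa T) {Cf : ℝ}
    (hCf : ∀ z s : ℂ, ‖z‖ ≤ R → s ∈ zfrRegion → 1 ≤ |s.im| →
      ‖zetaPow z s‖ ≤ Cf * Real.log (|s.im| + 3) ^ R) {p q : ℝ} (hpq : p ≤ q)
    (hfar : (1 ≤ p ∧ q ≤ T) ∨ (-T ≤ p ∧ q ≤ -1)) :
    ‖∫ t in p..q, integrand z G x (leftAbscissa T + t * I)‖ ≤
      4 * π * (x ^ (1 + leftAbscissa T) * (Cf * Real.log (T + 3) ^ R) * B) := by
  have hx0 : 0 < x := by linarith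
  set b := leftAbscissa T with hbdef
  have hb := (leftAbscissa_ge hT).2
  set M : ℝ := 4 * (x ^ (1 + b) * (Cf * Real.log (T + 3) ^ R) * B) with hM
  set g : ℝ → ℝ := fun t ↦ M * (1 + t ^ 2)⁻¹ with hg
  have hB0 : 0 ≤ B := (norm_nonneg _).trans (h.norm_G_le 2 (by
    have := leftAbscissa_lt_one (show (0:ℝ) ≤ T by linarith); simp; linarith))
  have hCf0 : 0 ≤ Cf := by
    have h2mem : (2 : ℂ) + 2 * I ∈ zfrRegion := mem_zfrRegion_of_one_le_re (by simp)
    have h1 := hCf z _ h.norm_le h2mem (by simp)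
    have h2 : 0 < Real.log (|((2 : ℂ) + 2 * I).im| + 3) ^ R :=
      Real.rpow_pos_of_pos (Real.log_pos (by simp; norm_num)) R
    exact (mul_nonneg_iff_of_pos_right h2).1 ((norm_nonneg _).trans h1)
  have hlog0 : 0 ≤ Real.log (T + 3) ^ R := (Real.rpow_pos_of_pos (Real.log_pos (by linarith)) R).le
  have hbd : ∀ᵐ t : ℝ, t ∈ Ioc p q → ‖integrand z G x (b + t * I)‖ ≤ g t := by
    refine Eventually.of_forall fun t ht ↦ ?_
    have him : ((b : ℂ) + t * I).im = t := by simp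
    have hre : ((b : ℂ) + t * I).re = b := by simp
    have ht1 : 1 ≤ |t| ∧ |t| ≤ T := by
      rcases hfar with ⟨h1, h2⟩ | ⟨h1, h2⟩
      · rw [abs_of_pos (by linarith [ht.1])]; exact ⟨by linarith [ht.1], by linarith [ht.2]⟩
      · rw [abs_of_neg (by linarith [ht.2])]; exact ⟨by linarith [ht.2], by linarith [ht.1]⟩
    have hmem : ((b : ℂ) + t * I) ∈ zfrRegion :=
      mem_zfrRegion_of_leftAbscissa_le hT (by rw [hre]) (by rw [him]; linarith [ht1.2])
    have hZ : ‖zetaPow z (b + t * I)‖ ≤ Cf * Real.log (T + 3) ^ R := by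
      have h1 := hCf z _ h.norm_le hmem (by rw [him]; exact ht1.1)
      rw [him] at h1
      refine h1.trans (mul_le_mul_of_nonneg_left ?_ hCf0)
      exact Real.rpow_le_rpow (Real.log_nonneg (by linarith [abs_nonneg t]))
        (Real.log_le_log (by positivity) (by linarith [ht1.2])) hR
    have hG : ‖G (b + t * I)‖ ≤ B := h.norm_G_le _ (by rw [hre]; exact hσ₁)
    have hK := norm_kernel_le_four_div hb.le t
    have hCfl : 0 ≤ Cf * Real.log (T + 3) ^ R := mul_nonneg hCf0 hlog0
    rw [integrand, norm_Phi_eq _ hx0, hre, norm_mul, hg, hM]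
    calc x ^ (1 + b) * (‖zetaPow z (b + t * I)‖ * ‖G (b + t * I)‖) * ‖kernel ((b : ℂ) + t * I)‖
        ≤ x ^ (1 + b) * ((Cf * Real.log (T + 3) ^ R) * B) * (4 * (1 + t ^ 2)⁻¹) :=
          mul_le_mul (mul_le_mul_of_nonneg_left (mul_le_mul hZ hG (norm_nonneg _) hCfl)
            (by positivity)) hK (norm_nonneg _)
            (mul_nonneg (by positivity) (mul_nonneg hCfl hB0))
      _ = _ := by ring
  have hM0 : 0 ≤ M := by
    rw [hM]
    exact mul_nonneg (by norm_num) (mul_nonneg (mul_nonneg (by positivity) (mul_nonneg hCf0 hlog0)) hB0)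
  have hgi : Integrable g := integrable_inv_one_add_sq.const_mul M
  have h1 := intervalIntegral.norm_integral_le_of_norm_le hpq hbd hgi.intervalIntegrable
  refine h1.trans ?_
  rw [intervalIntegral.integral_of_le hpq]
  calc ∫ t in Ioc p q, g t ≤ ∫ t, g t :=
        setIntegral_le_integral hgi (Eventually.of_forall fun t ↦ by simp only [hg]; positivity)
    _ = M * π := by rw [hg, MeasureTheory.integral_const_mul, integral_univ_inv_one_add_sq]
    _ = 4 * π * (x ^ (1 + b) * (Cf * Real.log (T + 3) ^ R) * B) := by rw [hM]; ring

/-! ### The left sides near `1`: `Re s = b(T)`, `δ ≤ |t| ≤ 1` -/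

/-- **The left sides near `1`**: with `‖exp(z log ζ₁(s))‖ ≤ Cn` on the box,
`‖∫ Φ(b + it) dt‖ ≤ 4 x^{1+b} Cn e^{πR} B ((1 − b)^{−R} + 2^R)` over any `[p, q] ⊆ [δ, 1]` or
`⊆ [−1, −δ]` (`0 < δ`). [cite: MontgomeryVaughan2007, §7.4 p. 178] -/
theorem norm_integral_left_near_le {R σ₁ B : ℝ} {z : ℂ} {a : ℕ → ℂ} {G : ℂ → ℂ}
    (h : RieszData R σ₁ B z a G) {x : ℝ} (hx : 1 ≤ x) {T : ℝ} (hT : 1 ≤ T)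
    (hσ₁ : σ₁ < leftAbscissa T) {Cn : ℝ}
    (hCn : ∀ z s : ℂ, ‖z‖ ≤ R → |s.im| ≤ 1 → 1 - zfrWidth 1 / 2 ≤ s.re → s.re ≤ 2 →
      ‖exp (z * logZeta₁ s)‖ ≤ Cn) {δ p q : ℝ} (hδ : 0 < δ) (hpq : p ≤ q)
    (hnear : (δ ≤ p ∧ q ≤ 1) ∨ (-1 ≤ p ∧ q ≤ -δ)) :
    ‖∫ t in p..q, integrand z G x (leftAbscissa T + t * I)‖ ≤
      4 * (x ^ (1 + leftAbscissa T) * Cn * Real.exp (π * R) * B *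
        ((1 - leftAbscissa T) ^ (-R) + 2 ^ R)) := by
  have hx0 : 0 < x := by linarith
  set b := leftAbscissa T with hbdef
  obtain ⟨hbw, hb⟩ := leftAbscissa_ge hT
  have hb1 := leftAbscissa_lt_one (show (0:ℝ) ≤ T by linarith)
  obtain ⟨h1b, h1bpos⟩ := one_sub_leftAbscissa (show (0:ℝ) ≤ T by linarith)
  have h1bpos' : 0 < 1 - b := by rw [hbdef, h1b]; exact h1bpos
  have hR : 0 ≤ R := (norm_nonneg _).trans h.norm_le
  have hm1 : 1 - b ≤ 1 := by linarith
  have hB0 : 0 ≤ B := (norm_nonneg _).trans (h.norm_G_le 2 (by simp; linarith))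
  have hCn0 : 0 ≤ Cn := (norm_nonneg _).trans (hCn z 2 h.norm_le (by simp)
    (by simp; linarith [zfrWidth_pos 1]) (by simp))
  have hlen : q - p ≤ 1 := by rcases hnear with ⟨h1, h2⟩ | ⟨h1, h2⟩ <;> linarith
  set K₀ : ℝ := x ^ (1 + b) * Cn * Real.exp (π * R) * B * ((1 - b) ^ (-R) + 2 ^ R) with hK₀
  have hK₀0 : 0 ≤ K₀ := by positivity
  have hbd : ∀ t ∈ Ι p q, ‖integrand z G x (b + t * I)‖ ≤ 4 * K₀ := by
    intro t ht
    rw [uIoc_of_le hpq] at ht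
    have htabs : δ ≤ |t| ∧ |t| ≤ 1 := by
      rcases hnear with ⟨h1, h2⟩ | ⟨h1, h2⟩
      · rw [abs_of_pos (by linarith [ht.1])]; exact ⟨by linarith [ht.1], by linarith [ht.2]⟩
      · rw [abs_of_neg (by linarith [ht.2])]; exact ⟨by linarith [ht.2], by linarith [ht.1]⟩
    set s : ℂ := (b : ℂ) + t * I with hsdef
    have him : s.im = t := by simp [hsdef]
    have hre : s.re = b := by simp [hsdef]
    have hs1 : s ≠ 1 := fun h1 ↦ by
      have := congrArg Complex.im h1; rw [him] at this; simp at this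
      rw [this, abs_zero] at htabs; linarith [htabs.1]
    have hZ' : ‖zetaPow z s‖ ≤ Cn * (‖s - 1‖ ^ (-z.re) * Real.exp (π * |z.im|)) := by
      rw [zetaPow, norm_mul]
      exact mul_le_mul (hCn z s h.norm_le (by rw [him]; exact htabs.2) (by rw [hre]; exact hbw)
        (by rw [hre]; linarith)) (norm_cpow_neg_le (sub_ne_zero.2 hs1) z) (norm_nonneg _) hCn0
    have hlow : 1 - b ≤ ‖s - 1‖ := by
      have := abs_re_le_norm (s - 1)
      rw [sub_re, hre, one_re, abs_sub_comm, abs_of_pos h1bpos'] at this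
      exact this
    have hup : ‖s - 1‖ ≤ 2 := by
      calc ‖s - 1‖ ≤ |(s - 1).re| + |(s - 1).im| := Complex.norm_le_abs_re_add_abs_im _
        _ = |b - 1| + |t| := by simp [hsdef]
        _ ≤ 1 + 1 := add_le_add (by rw [abs_sub_comm, abs_of_pos h1bpos']; linarith) htabs.2
        _ = 2 := by norm_num
    have hpow : ‖s - 1‖ ^ (-z.re) ≤ (1 - b) ^ (-R) + 2 ^ R :=
      rpow_neg_re_le_add h1bpos' hlow hup (by norm_num) hm1 ((abs_re_le_norm z).trans h.norm_le)
    have hexp := exp_pi_mul_abs_im_le h.norm_le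
    have hG : ‖G s‖ ≤ B := h.norm_G_le s (by rw [hre]; exact hσ₁)
    have hK : ‖kernel s‖ ≤ 4 := by
      have h4 := norm_kernel_le_four_div hb.le t
      rw [← hsdef] at h4
      refine h4.trans ?_
      have : (1 + t ^ 2)⁻¹ ≤ 1 := inv_le_one_of_one_le₀ (by nlinarith)
      linarith [mul_le_mul_of_nonneg_left this (by norm_num : (0:ℝ) ≤ 4)]
    rw [integrand, norm_Phi_eq _ hx0, hre, norm_mul, hK₀]
    calc x ^ (1 + b) * (‖zetaPow z s‖ * ‖G s‖) * ‖kernel s‖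
        ≤ x ^ (1 + b) * ((Cn * (((1 - b) ^ (-R) + 2 ^ R) * Real.exp (π * R))) * B) * 4 := by
          refine mul_le_mul (mul_le_mul_of_nonneg_left (mul_le_mul (hZ'.trans ?_) hG (norm_nonneg _)
            (by positivity)) (by positivity)) hK (norm_nonneg _) (by positivity)
          exact mul_le_mul_of_nonneg_left (mul_le_mul hpow hexp (Real.exp_pos _).le (by positivity)) hCn0
      _ = 4 * (x ^ (1 + b) * Cn * Real.exp (π * R) * B * ((1 - b) ^ (-R) + 2 ^ R)) := by ring
  have := intervalIntegral.norm_integral_le_of_norm_le_const hbd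
  rw [abs_of_nonneg (sub_nonneg.2 hpq)] at this
  calc ‖∫ t in p..q, integrand z G x (b + t * I)‖ ≤ 4 * K₀ * (q - p) := this
    _ ≤ 4 * K₀ * 1 := by gcongr
    _ = 4 * K₀ := by ring

/-! ### Interval integrability on the left sides -/

/-- The integrand is continuous at the points `b(T) + it`, `t ≠ 0`, `|t| ≤ T + 1` (`x > 0`,
`σ₁ < b(T)`), hence interval integrable on any `[p, q]` avoiding `t = 0`. [folklore] -/
theorem intervalIntegrable_left {R σ₁ B : ℝ} {z : ℂ} {a : ℕ → ℂ} {G : ℂ → ℂ}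
    (h : RieszData R σ₁ B z a G) {x : ℝ} (hx : 0 < x) {T : ℝ} (hT : 1 ≤ T)
    (hσ₁ : σ₁ < leftAbscissa T) {p q : ℝ} (hpq : p ≤ q) (h0 : 0 < p ∨ q < 0) (hp : -(T + 1) ≤ p)
    (hq : q ≤ T + 1) :
    IntervalIntegrable (fun t : ℝ ↦ integrand z G x (leftAbscissa T + t * I)) volume p q := by
  refine Literature.Analysis.Complex.intervalIntegrable_of_continuousAt_vertical (leftAbscissa T) hpq
    fun t ht ↦ ?_
  have him : ((leftAbscissa T : ℂ) + t * I).im = t := by simp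
  have hre : ((leftAbscissa T : ℂ) + t * I).re = leftAbscissa T := by simp
  have hb := (leftAbscissa_ge hT).2
  have ht0 : t ≠ 0 := by
    rcases h0 with h0 | h0
    · exact (h0.trans_le ht.1).ne'
    · exact (ht.2.trans_lt h0).ne
  exact (differentiableAt_integrand h hx (mem_zfrRegion_of_leftAbscissa_le hT (by rw [hre])
    (by rw [him]; exact abs_le.2 ⟨by linarith [ht.1], by linarith [ht.2]⟩)) (by rw [him]; exact ht0)
    (by rw [hre]; exact hσ₁) (by rw [hre]; linarith)).continuousAt

/-- `x^{1 + σ} = x² e^{L(σ−1)}` for `x > 1`, `L = log x`. [folklore] -/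
theorem rpow_one_add_eq {x : ℝ} (hx : 1 < x) (σ : ℝ) :
    x ^ (1 + σ) = x ^ 2 * Real.exp (Real.log x * (σ - 1)) := by
  have hx0 : 0 < x := by linarith
  have hxL : Real.exp (Real.log x) = x := Real.exp_log hx0
  calc x ^ (1 + σ) = Real.exp (Real.log x) ^ (1 + σ) := by rw [hxL]
    _ = Real.exp (Real.log x * (1 + σ)) := (Real.exp_mul _ _).symm
    _ = Real.exp (Real.log x) * Real.exp (Real.log x) * Real.exp (Real.log x * (σ - 1)) := by
        rw [← Real.exp_add, ← Real.exp_add]; congr 1; ring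
    _ = x ^ 2 * Real.exp (Real.log x * (σ - 1)) := by rw [hxL, sq]

/-! ### The estimate at a fixed `x`, for admissible parameters -/

/-- Norm of a power of the positive real `L` with complex exponent. [folklore] -/
theorem norm_ofReal_cpow {L : ℝ} (hL : 0 < L) (w : ℂ) : ‖(L : ℂ) ^ w‖ = L ^ w.re :=
  norm_cpow_eq_rpow_re_of_pos hL w

/-- `L^{e} ≤ L^{R}` for `L ≥ 1` and `e ≤ R`. [folklore] -/
theorem rpow_le_rpow_of_le {L e R : ℝ} (hL : 1 ≤ L) (h : e ≤ R) : L ^ e ≤ L ^ R :=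
  Real.rpow_le_rpow_of_exponent_le hL h

/-- The Taylor coefficients are bounded: `‖coeff_k‖ ≤ M (2/ρ)^k` when `‖𝒢‖ ≤ M` on `ball 1 ρ`.
[folklore] -/
theorem norm_coeff_le {z : ℂ} {G : ℂ → ℂ} {ρ M : ℝ} (hρ : 0 < ρ)
    (hd : DifferentiableOn ℂ (smoothPart z G) (ball 1 ρ)) (hM : ∀ s ∈ ball 1 ρ, ‖smoothPart z G s‖ ≤ M)
    (k : ℕ) : ‖coeff z G k‖ ≤ M * (2 / ρ) ^ k := by
  have h := norm_iteratedDeriv_le_of_forall_mem_ball hρ hd hM k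
  have hk : (0 : ℝ) < k ! := by exact_mod_cast Nat.factorial_pos k
  rw [coeff, norm_mul, norm_inv, Complex.norm_natCast]
  calc (k ! : ℝ)⁻¹ * ‖iteratedDeriv k (smoothPart z G) 1‖ ≤ (k ! : ℝ)⁻¹ * (k ! * M / (ρ / 2) ^ k) := by
        gcongr
    _ = M * (2 / ρ) ^ k := by
        have hρ2 : (ρ / 2) ^ k ≠ 0 := pow_ne_zero _ (by positivity)
        have hf : (k ! : ℝ) ≠ 0 := hk.ne'
        have e : ((2 : ℝ) / ρ) ^ k = ((ρ / 2) ^ k)⁻¹ := by rw [← inv_pow, inv_div]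
        rw [e]
        field_simp

/-- **The Selberg–Delange estimate for the Riesz mean at a fixed `x`** with admissible parameters
(`L = log x ≥ 1`, `T ≥ 1`, `σ₁ < b = b(T)`, `β = L(1 − b) ≥ 1`, `(β + 1)/L ≤ ρ/4`):
`‖A₁(x) − x² Σ_{k<N} coeff_k Γ(z−k)⁻¹ L^{z−1−k}‖ ≤ (2π)⁻¹ · (tails + horizontal sides + left sides
far + left sides near + Hankel truncation + Taylor remainder)`, each term explicit.
[cite: MontgomeryVaughan2007, §7.4 pp. 177–178] -/
theorem norm_rieszMean_sub_le {R σ₁ B : ℝ} {z : ℂ} {a : ℕ → ℂ} {G : ℂ → ℂ}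
    (h : RieszData R σ₁ B z a G) (hσ₁1 : σ₁ < 1) {N : ℕ} {Cf Cn CH K : ℝ}
    (hCf : ∀ z s : ℂ, ‖z‖ ≤ R → s ∈ zfrRegion → 1 ≤ |s.im| →
      ‖zetaPow z s‖ ≤ Cf * Real.log (|s.im| + 3) ^ R)
    (hCn : ∀ z s : ℂ, ‖z‖ ≤ R → |s.im| ≤ 1 → 1 - zfrWidth 1 / 2 ≤ s.re → s.re ≤ 2 →
      ‖exp (z * logZeta₁ s)‖ ≤ Cn)
    (hCH : 0 ≤ CH ∧ ∀ β : ℝ, 1 ≤ β → ∀ ζ : ℂ, ‖ζ‖ ≤ R + N →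
      ‖hankelLoop β ζ - 2 * π * I / Complex.Gamma ζ‖ ≤ CH * Real.exp (-β / 2))
    (hK : 0 < K ∧ ∀ (𝒢 : ℂ → ℂ) (ρ M : ℝ), 0 < ρ → DifferentiableOn ℂ 𝒢 (ball 1 ρ) →
      (∀ s ∈ ball 1 ρ, ‖𝒢 s‖ ≤ M) → ∀ (x β : ℝ), 1 < x → 1 ≤ β → (β + 1) / Real.log x ≤ ρ / 4 →
      ∀ z : ℂ, ‖z‖ ≤ R →
      ‖keyhole (fun s ↦ (s - 1) ^ (-z) * 𝒢 s * (x : ℂ) ^ (1 + s))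
          (1 - β / Real.log x) (1 + 1 / Real.log x) (1 / Real.log x) -
        ∑ k ∈ Finset.range N, (k ! : ℂ)⁻¹ * iteratedDeriv k 𝒢 1 *
          ((x : ℂ) ^ 2 * (Real.log x : ℂ) ^ ((z - k) - 1) * hankelLoop β (z - k))‖ ≤
        K * (M / ρ ^ N) * x ^ 2 * Real.log x ^ (z.re - N - 1))
    {x : ℝ} (hx : 1 < x) (hL : 1 ≤ Real.log x) {T : ℝ} (hT : 1 ≤ T)
    (hσ₁b : σ₁ < leftAbscissa T)
    (hβ : 1 ≤ Real.log x * (1 - leftAbscissa T))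
    (hfit : (Real.log x * (1 - leftAbscissa T) + 1) / Real.log x ≤ rho σ₁ / 4) :
    ‖(∑ n ∈ Finset.Ioc 0 ⌊x⌋₊, a n * ((x : ℂ) - n)) -
        (x : ℂ) ^ 2 * ∑ k ∈ Finset.range N, coeff z G k * (Complex.Gamma (z - k))⁻¹ *
          (Real.log x : ℂ) ^ (z - 1 - k)‖ ≤
      (2 * π)⁻¹ * (
        2 * (Real.exp 1 * x ^ 2 * (B / (1 / Real.log x) ^ R) / T) +
        2 * ((1 + 1 / Real.log x - leftAbscissa T) *
          (Real.exp 1 * x ^ 2 * (Cf * Real.log (T + 3) ^ R) * B / T ^ 2)) +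
        2 * (4 * π * (x ^ 2 * Real.exp (-(Real.log x * (1 - leftAbscissa T))) *
          (Cf * Real.log (T + 3) ^ R) * B)) +
        2 * (4 * (x ^ 2 * Real.exp (-(Real.log x * (1 - leftAbscissa T))) * Cn *
          Real.exp (π * R) * B * ((1 - leftAbscissa T) ^ (-R) + 2 ^ R))) +
        N * ((Cn * B * 2) * (2 / rho σ₁) ^ N * x ^ 2 * Real.log x ^ R *
          (CH * Real.exp (-(Real.log x * (1 - leftAbscissa T)) / 2))) +
        K * ((Cn * B * 2) / rho σ₁ ^ N) * x ^ 2 * Real.log x ^ (z.re - N - 1)) := by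
  -- parameters
  set L : ℝ := Real.log x with hLdef
  have hL0 : 0 < L := by linarith
  have hx0 : 0 < x := by linarith
  have hx1 : 1 ≤ x := hx.le
  set aa : ℝ := 1 + 1 / L with haa
  have haa1 : 1 < aa := by linarith [show (0:ℝ) < 1 / L by positivity]
  have haa2 : aa ≤ 2 := by
    have : 1 / L ≤ 1 := by rw [div_le_one hL0]; exact hL
    linarith
  set δ : ℝ := 1 / L with hδ
  have hδ0 : 0 < δ := by positivity
  have hδ1 : δ ≤ 1 := by rw [hδ, div_le_one hL0]; exact hL
  set b : ℝ := leftAbscissa T with hbdef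
  set β : ℝ := L * (1 - b) with hβdef
  have hb1 : b < 1 := leftAbscissa_lt_one (by linarith)
  have hbβ : b = 1 - β / L := by rw [hβdef]; field_simp; ring
  have hba : b ≤ aa := by linarith
  have hR : 0 ≤ R := (norm_nonneg _).trans h.norm_le
  obtain ⟨hρ, hρw, hρ4⟩ := rho_pos hσ₁1
  set ρ : ℝ := rho σ₁ with hρdef
  set M : ℝ := Cn * B * 2 with hMdef
  have hB0 : 0 ≤ B := (norm_nonneg _).trans (h.norm_G_le 2 (by simp; linarith))
  have hCn0 : 0 ≤ Cn := (norm_nonneg _).trans (hCn z 2 h.norm_le (by simp)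
    (by simp; linarith [zfrWidth_pos 1]) (by simp))
  have hM0 : 0 ≤ M := by positivity
  -- the smooth part on the ball
  have hdiff𝒢 := differentiableOn_smoothPart h hσ₁1
  have hM𝒢 : ∀ s ∈ ball (1 : ℂ) ρ, ‖smoothPart z G s‖ ≤ M := fun s hs ↦
    norm_smoothPart_le h hσ₁1 hCn hs
  -- Perron's formula for the Riesz mean
  set J : ℂ := ∫ t : ℝ, integrand z G x (aa + t * I) with hJ
  have hA : ∑ n ∈ Finset.Ioc 0 ⌊x⌋₊, a n * ((x : ℂ) - n) = (1 / (2 * π) : ℂ) * J := by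
    rw [RieszMean.sum_mul_sub_eq_integral_LSeries a hx0 (by linarith : 0 < aa) (h.summable aa haa1)]
    congr 1
    exact integral_congr_ae (Eventually.of_forall fun t ↦ (integrand_line_eq h x haa1 t).symm)
  -- the decomposition of the line integral
  have hint := integrable_integrand_line h hx0 haa1
  have hdec := line_integral_eq_keyhole (Φ := integrand z G x) hba (by linarith : δ ≤ T) hint
    (differentiableOn_integrand_rect h hx0 hT hδ0 hσ₁b (Or.inl ⟨le_rfl, le_rfl⟩))
    (differentiableOn_integrand_rect h hx0 hT hδ0 hσ₁b (Or.inr ⟨le_rfl, le_rfl⟩))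
  set Tails : ℂ := (∫ t in Iic (-T), integrand z G x (aa + t * I)) +
    ∫ t in Ioi T, integrand z G x (aa + t * I) with hTails
  set KH : ℂ := keyhole (integrand z G x) b aa δ with hKH
  set Hor : ℂ := (∫ u in b..aa, integrand z G x (u + T * I)) -
    ∫ u in b..aa, integrand z G x (u + (-T) * I) with hHor
  set Left : ℂ := (∫ t in (-T)..(-δ), integrand z G x (b + t * I)) +
    ∫ t in δ..T, integrand z G x (b + t * I) with hLeft
  have hdec' : I * J = I * Tails + KH + Hor + I * Left := hdec
  -- the keyhole: Taylor expansion
  set MainK : ℂ := ∑ k ∈ Finset.range N, coeff z G k *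
    ((x : ℂ) ^ 2 * (L : ℂ) ^ ((z - k) - 1) * hankelLoop β (z - k)) with hMainK
  have hEK : ‖KH - MainK‖ ≤ K * (M / ρ ^ N) * x ^ 2 * L ^ (z.re - N - 1) := by
    have hfit' : (β + 1) / Real.log x ≤ ρ / 4 := hfit
    have := hK.2 (smoothPart z G) ρ M hρ hdiff𝒢 hM𝒢 x β hx hβ hfit' z h.norm_le
    have hΦ : (fun s ↦ (s - 1) ^ (-z) * smoothPart z G s * (x : ℂ) ^ (1 + s)) = integrand z G x :=
      funext fun s ↦ (integrand_eq z G x s).symm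
    rw [hΦ, ← hLdef, ← hbβ] at this
    simpa only [hKH, hMainK, coeff, haa, hδ] using this
  -- the Hankel loops
  set MainS : ℂ := ∑ k ∈ Finset.range N, coeff z G k *
    ((x : ℂ) ^ 2 * (L : ℂ) ^ ((z - k) - 1) * (2 * π * I / Complex.Gamma (z - k))) with hMainS
  have hEH : ‖MainK - MainS‖ ≤ N * (M * (2 / ρ) ^ N * x ^ 2 * L ^ R * (CH * Real.exp (-β / 2))) := by
    rw [hMainK, hMainS, ← Finset.sum_sub_distrib]
    have hterm : ∀ k ∈ Finset.range N, ‖coeff z G k * ((x : ℂ) ^ 2 * (L : ℂ) ^ ((z - k) - 1) *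
        hankelLoop β (z - k)) - coeff z G k * ((x : ℂ) ^ 2 * (L : ℂ) ^ ((z - k) - 1) *
        (2 * π * I / Complex.Gamma (z - k)))‖ ≤
        M * (2 / ρ) ^ N * x ^ 2 * L ^ R * (CH * Real.exp (-β / 2)) := by
      intro k hk
      rw [Finset.mem_range] at hk
      rw [← mul_sub, ← mul_sub, norm_mul, norm_mul, norm_mul, norm_ofReal_cpow hL0,
        Complex.norm_pow, Complex.norm_real, Real.norm_of_nonneg hx0.le]
      have hc : ‖coeff z G k‖ ≤ M * (2 / ρ) ^ N := by
        refine (norm_coeff_le hρ hdiff𝒢 hM𝒢 k).trans ?_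
        refine mul_le_mul_of_nonneg_left (pow_le_pow_right₀ ?_ hk.le) hM0
        rw [le_div_iff₀ hρ]; linarith
      have hLe : L ^ ((z - k) - 1 : ℂ).re ≤ L ^ R := by
        refine rpow_le_rpow_of_le hL ?_
        simp only [sub_re, one_re, natCast_re]
        have := (abs_re_le_norm z).trans h.norm_le
        have hk0 : (0 : ℝ) ≤ k := Nat.cast_nonneg k
        linarith [le_abs_self z.re]
      have hH := hCH.2 β hβ (z - k) (by
        calc ‖z - (k : ℂ)‖ ≤ ‖z‖ + ‖(k : ℂ)‖ := norm_sub_le _ _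
          _ ≤ R + N := by
              rw [Complex.norm_natCast]; exact add_le_add h.norm_le (by exact_mod_cast hk.le))
      have h0 : 0 ≤ CH * Real.exp (-β / 2) := mul_nonneg hCH.1 (Real.exp_pos _).le
      calc ‖coeff z G k‖ * (x ^ 2 * L ^ ((z - k) - 1 : ℂ).re * ‖hankelLoop β (z - ↑k) -
            2 * π * I / Complex.Gamma (z - k)‖)
          ≤ (M * (2 / ρ) ^ N) * (x ^ 2 * L ^ R * (CH * Real.exp (-β / 2))) := by
            refine mul_le_mul hc ?_ (by positivity) (by positivity)
            exact mul_le_mul (mul_le_mul_of_nonneg_left hLe (by positivity)) hH (norm_nonneg _)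
              (by positivity)
        _ = _ := by ring
    calc ‖∑ k ∈ Finset.range N, (coeff z G k * ((x : ℂ) ^ 2 * (L : ℂ) ^ ((z - k) - 1) *
          hankelLoop β (z - k)) - coeff z G k * ((x : ℂ) ^ 2 * (L : ℂ) ^ ((z - k) - 1) *
          (2 * π * I / Complex.Gamma (z - k))))‖
        ≤ ∑ k ∈ Finset.range N, M * (2 / ρ) ^ N * x ^ 2 * L ^ R * (CH * Real.exp (-β / 2)) :=
          norm_sum_le_of_le _ hterm
      _ = N * (M * (2 / ρ) ^ N * x ^ 2 * L ^ R * (CH * Real.exp (-β / 2))) := by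
          rw [Finset.sum_const, Finset.card_range, nsmul_eq_mul]
  -- the main term of the statement is `MainS / (2πi)`
  set Main : ℂ := (x : ℂ) ^ 2 * ∑ k ∈ Finset.range N, coeff z G k * (Complex.Gamma (z - k))⁻¹ *
    (L : ℂ) ^ (z - 1 - k) with hMain
  have hMainS' : MainS = 2 * π * I * Main := by
    rw [hMainS, hMain, Finset.mul_sum, Finset.mul_sum]
    refine Finset.sum_congr rfl fun k _ ↦ ?_
    have : (z - k) - 1 = z - 1 - (k : ℂ) := by ring
    rw [this]
    ring
  -- tails
  have hS : ∑' n : ℕ, ‖LSeries.term a (aa : ℂ) n‖ ≤ B / (1 / L) ^ R := by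
    have := h.majorant aa haa1 haa2
    rwa [show aa - 1 = 1 / L by rw [haa]; ring] at this
  have hxaa : x ^ (1 + aa) = Real.exp 1 * x ^ 2 := by
    rw [rpow_one_add_eq hx, haa, show Real.log x * (1 + 1 / L - 1) = 1 by rw [← hLdef]; field_simp; ring]
    ring
  have hxb : x ^ (1 + b) = x ^ 2 * Real.exp (-(L * (1 - b))) := by
    rw [rpow_one_add_eq hx, ← hLdef]; congr 1; congr 1; ring
  obtain ⟨htail1, htail2⟩ := norm_integral_tails_le h hx0 haa1 (by linarith : 0 < T)
  have hS0 : 0 ≤ ∑' n : ℕ, ‖LSeries.term a (aa : ℂ) n‖ := tsum_nonneg fun _ ↦ norm_nonneg _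
  have htailB : x ^ (1 + aa) * (∑' n : ℕ, ‖LSeries.term a (aa : ℂ) n‖) / T ≤
      Real.exp 1 * x ^ 2 * (B / (1 / L) ^ R) / T := by
    rw [hxaa]
    exact div_le_div_of_nonneg_right (mul_le_mul_of_nonneg_left hS (by positivity)) (by linarith)
  have hTails : ‖Tails‖ ≤ 2 * (Real.exp 1 * x ^ 2 * (B / (1 / L) ^ R) / T) := by
    calc ‖Tails‖ ≤ ‖∫ t in Iic (-T), integrand z G x (aa + t * I)‖ +
          ‖∫ t in Ioi T, integrand z G x (aa + t * I)‖ := norm_add_le _ _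
      _ ≤ _ := by linarith [htail1.trans htailB, htail2.trans htailB]
  -- horizontal sides
  have hhor1 := norm_integral_horizontal_le h hx1 hT hσ₁b hba hCf (T' := T) (abs_of_pos (by linarith))
  have hhor2 := norm_integral_horizontal_le h hx1 hT hσ₁b hba hCf (T' := -T)
    (by rw [abs_neg, abs_of_pos (by linarith)])
  have hHor : ‖Hor‖ ≤ 2 * ((aa - b) * (Real.exp 1 * x ^ 2 * (Cf * Real.log (T + 3) ^ R) * B / T ^ 2)) := by
    rw [hxaa] at hhor1 hhor2
    calc ‖Hor‖ ≤ ‖∫ u in b..aa, integrand z G x (u + T * I)‖ +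
          ‖∫ u in b..aa, integrand z G x (u + (-T) * I)‖ := norm_sub_le _ _
      _ ≤ _ := by push_cast at hhor2 ⊢; linarith [hhor1, hhor2]
  -- left sides
  have hii := fun (p q : ℝ) (hpq : p ≤ q) (h0 : 0 < p ∨ q < 0) (hp : -(T + 1) ≤ p) (hq : q ≤ T + 1) ↦
    intervalIntegrable_left h hx0 hT hσ₁b hpq h0 hp hq
  have hsplit1 : ∫ t in δ..T, integrand z G x (b + t * I) =
      (∫ t in δ..(1:ℝ), integrand z G x (b + t * I)) + ∫ t in (1:ℝ)..T, integrand z G x (b + t * I) :=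
    (intervalIntegral.integral_add_adjacent_intervals (hii δ 1 hδ1 (Or.inl hδ0) (by linarith) (by linarith))
      (hii 1 T hT (Or.inl one_pos) (by linarith) (by linarith))).symm
  have hsplit2 : ∫ t in (-T)..(-δ), integrand z G x (b + t * I) =
      (∫ t in (-T)..(-1:ℝ), integrand z G x (b + t * I)) +
        ∫ t in (-1:ℝ)..(-δ), integrand z G x (b + t * I) :=
    (intervalIntegral.integral_add_adjacent_intervals
      (hii (-T) (-1) (by linarith) (Or.inr (by norm_num)) (by linarith) (by linarith))
      (hii (-1) (-δ) (by linarith) (Or.inr (by linarith)) (by linarith) (by linarith))).symm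
  have hfar1 := norm_integral_left_far_le h hR hx1 hT hσ₁b hCf hT (Or.inl ⟨le_rfl, le_rfl⟩)
  have hfar2 := norm_integral_left_far_le h hR hx1 hT hσ₁b hCf (show -T ≤ -1 by linarith)
    (Or.inr ⟨le_rfl, le_rfl⟩)
  have hnear1 := norm_integral_left_near_le h hx1 hT hσ₁b hCn hδ0 hδ1 (Or.inl ⟨le_rfl, le_rfl⟩)
  have hnear2 := norm_integral_left_near_le h hx1 hT hσ₁b hCn hδ0 (show -1 ≤ -δ by linarith)
    (Or.inr ⟨le_rfl, le_rfl⟩)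
  rw [hxb] at hfar1 hfar2 hnear1 hnear2
  have hLeftB : ‖Left‖ ≤
      2 * (4 * π * (x ^ 2 * Real.exp (-(L * (1 - b))) * (Cf * Real.log (T + 3) ^ R) * B)) +
      2 * (4 * (x ^ 2 * Real.exp (-(L * (1 - b))) * Cn * Real.exp (π * R) * B *
        ((1 - b) ^ (-R) + 2 ^ R))) := by
    rw [hLeft, hsplit1, hsplit2]
    calc ‖(∫ t in (-T)..(-1:ℝ), integrand z G x (b + t * I)) +
          (∫ t in (-1:ℝ)..(-δ), integrand z G x (b + t * I)) +
          ((∫ t in δ..(1:ℝ), integrand z G x (b + t * I)) + ∫ t in (1:ℝ)..T, integrand z G x (b + t * I))‖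
        ≤ ‖∫ t in (-T)..(-1:ℝ), integrand z G x (b + t * I)‖ +
          ‖∫ t in (-1:ℝ)..(-δ), integrand z G x (b + t * I)‖ +
          (‖∫ t in δ..(1:ℝ), integrand z G x (b + t * I)‖ + ‖∫ t in (1:ℝ)..T, integrand z G x (b + t * I)‖) :=
          norm_add_le_of_le (norm_add_le _ _) (norm_add_le _ _)
      _ ≤ _ := by linarith [hfar1, hfar2, hnear1, hnear2]
  -- assemble
  have key : 2 * π * I * ((∑ n ∈ Finset.Ioc 0 ⌊x⌋₊, a n * ((x : ℂ) - n)) - Main) =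
      I * Tails + (KH - MainK) + Hor + I * Left + (MainK - MainS) := by
    have hπ : (π : ℂ) ≠ 0 := ofReal_ne_zero.2 Real.pi_pos.ne'
    have e1 : 2 * π * I * ((1 / (2 * π) : ℂ) * J) = I * J := by field_simp
    rw [hA, mul_sub, e1, hdec', hMainS']
    ring
  have hnorm : ‖(∑ n ∈ Finset.Ioc 0 ⌊x⌋₊, a n * ((x : ℂ) - n)) - Main‖ =
      (2 * π)⁻¹ * ‖I * Tails + (KH - MainK) + Hor + I * Left + (MainK - MainS)‖ := by
    rw [← key, norm_mul, norm_mul, norm_mul, Complex.norm_I, Complex.norm_real,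
      Real.norm_of_nonneg Real.pi_pos.le, Complex.norm_two]
    field_simp
  rw [hnorm]
  refine mul_le_mul_of_nonneg_left ?_ (by positivity)
  have htri : ‖I * Tails + (KH - MainK) + Hor + I * Left + (MainK - MainS)‖ ≤
      ‖Tails‖ + ‖KH - MainK‖ + ‖Hor‖ + ‖Left‖ + ‖MainK - MainS‖ := by
    have e1 : ‖I * Tails‖ = ‖Tails‖ := by rw [norm_mul, Complex.norm_I, one_mul]
    have e2 : ‖I * Left‖ = ‖Left‖ := by rw [norm_mul, Complex.norm_I, one_mul]
    calc _ ≤ ‖I * Tails + (KH - MainK) + Hor + I * Left‖ + ‖MainK - MainS‖ := norm_add_le _ _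
      _ ≤ ‖I * Tails + (KH - MainK) + Hor‖ + ‖I * Left‖ + ‖MainK - MainS‖ := by
          gcongr; exact norm_add_le _ _
      _ ≤ ‖I * Tails + (KH - MainK)‖ + ‖Hor‖ + ‖I * Left‖ + ‖MainK - MainS‖ := by
          gcongr; exact norm_add_le _ _
      _ ≤ ‖I * Tails‖ + ‖KH - MainK‖ + ‖Hor‖ + ‖I * Left‖ + ‖MainK - MainS‖ := by
          gcongr; exact norm_add_le _ _
      _ = _ := by rw [e1, e2]
  refine htri.trans ?_
  have haab : aa - b = 1 + 1 / L - b := by rw [haa]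
  rw [haab] at hHor
  linarith [hTails, hEK, hHor, hLeftB, hEH]

/-! ### Choice of the parameters and the asymptotic estimate -/

/-- The eventual inequalities in `L = log x` used to choose `T = L^κ`:
for every `κ ≥ 1`, `ε > 0`, `A`, `L₁`, eventually `L ≥ L₁`, `log L ≥ A` and `(log L)² ≤ ε L`. [folklore] -/
theorem eventually_params (ε : ℝ) (hε : 0 < ε) (A L₁ : ℝ) :
    ∀ᶠ L : ℝ in atTop, L₁ ≤ L ∧ A ≤ Real.log L ∧ Real.log L ^ 2 ≤ ε * L := by
  have h1 : ∀ᶠ L : ℝ in atTop, L₁ ≤ L := eventually_ge_atTop L₁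
  have h2 : ∀ᶠ L : ℝ in atTop, A ≤ Real.log L := Real.tendsto_log_atTop.eventually_ge_atTop A
  have h3 : ∀ᶠ L : ℝ in atTop, Real.log L ^ 2 ≤ ε * L := by
    have h := (Real.isLittleO_pow_log_id_atTop (n := 2)).bound hε
    filter_upwards [h, eventually_ge_atTop (0 : ℝ)] with L hL hL0
    rw [Real.norm_of_nonneg (sq_nonneg _), id, Real.norm_of_nonneg hL0] at hL
    exact hL
  exact (h1.and h2).and h3 |>.mono fun L h ↦ ⟨h.1.1, h.1.2, h.2⟩

/-- Bounds for `log(T + 3)` when `T = L^κ`, `κ ≥ 1`, `L ≥ 3`: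
`κ log L ≤ log(T+3) ≤ (κ + 1) log L`, and `1 ≤ log L`, `3 ≤ T`. [folklore] -/
theorem log_rpow_add_three_bounds {L κ : ℝ} (hL : 3 ≤ L) (hκ : 1 ≤ κ) :
    κ * Real.log L ≤ Real.log (L ^ κ + 3) ∧ Real.log (L ^ κ + 3) ≤ (κ + 1) * Real.log L ∧
      1 ≤ Real.log L ∧ 3 ≤ L ^ κ := by
  have hL0 : 0 < L := by linarith
  have hlogL : 1 ≤ Real.log L := by
    rw [← Real.log_exp 1]
    exact Real.log_le_log (Real.exp_pos 1) (by linarith [Real.exp_one_lt_d9])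
  have hT3 : 3 ≤ L ^ κ := by
    calc (3 : ℝ) ≤ L := hL
      _ = L ^ (1 : ℝ) := (Real.rpow_one L).symm
      _ ≤ L ^ κ := Real.rpow_le_rpow_of_exponent_le (by linarith) hκ
  have hT0 : 0 < L ^ κ := by positivity
  refine ⟨?_, ?_, hlogL, hT3⟩
  · rw [← Real.log_rpow hL0]
    exact Real.log_le_log hT0 (by linarith)
  · have h2 : L ^ κ + 3 ≤ L ^ κ * L :=
      calc L ^ κ + 3 ≤ L ^ κ + L ^ κ := by linarith
        _ = L ^ κ * 2 := by ring
        _ ≤ L ^ κ * L := mul_le_mul_of_nonneg_left (by linarith) hT0.le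
    calc Real.log (L ^ κ + 3) ≤ Real.log (L ^ κ * L) := Real.log_le_log (by linarith) h2
      _ = κ * Real.log L + Real.log L := by rw [Real.log_mul hT0.ne' hL0.ne', Real.log_rpow hL0]
      _ = (κ + 1) * Real.log L := by ring

set_option maxHeartbeats 1600000 in
/-- **The Selberg–Delange expansion of the Riesz mean** (MV §7.4, proof of Theorem 7.17, in the
Riesz-mean arrangement of Tenenbaum II.5 §5.4, to any order `N`): for `0 ≤ R ≤ N`, `σ₁ < 1` and `B`
there are `C` and `x₀ > 1` such that for every `z, a, G` satisfying `RieszData R σ₁ B z a G` and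
every `x ≥ x₀`,
`‖∑_{n ≤ x} a(n)(x − n) − x² ∑_{k<N} coeff_k Γ(z−k)⁻¹ (log x)^{z−1−k}‖ ≤ C x² (log x)^{Re z − 1 − N}`,
where `coeff_k = (k!)⁻¹ 𝒢⁽ᵏ⁾(1)`, `𝒢(s) = exp(z log ζ₁(s)) G(s)/(s(s+1))` (so `coeff_0 = G(1)/2`).
[cite: MontgomeryVaughan2007, §7.4 Theorem 7.17 (proof, pp. 177–178)]
[cite: Tenenbaum2015, II.5 §5.4 Theorem 5.2] -/
theorem exists_riesz_expansion (R σ₁ B : ℝ) (hR : 0 ≤ R) (hσ₁ : σ₁ < 1) (N : ℕ) (hN : R ≤ N) :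
    ∃ C x₀ : ℝ, 1 < x₀ ∧ ∀ (z : ℂ) (a : ℕ → ℂ) (G : ℂ → ℂ), RieszData R σ₁ B z a G →
      ∀ x : ℝ, x₀ ≤ x →
        ‖(∑ n ∈ Finset.Ioc 0 ⌊x⌋₊, a n * ((x : ℂ) - n)) -
            (x : ℂ) ^ 2 * ∑ k ∈ Finset.range N, coeff z G k * (Complex.Gamma (z - k))⁻¹ *
              (Real.log x : ℂ) ^ (z - 1 - k)‖ ≤ C * x ^ 2 * Real.log x ^ (z.re - 1 - N) := by
  -- the constants
  obtain ⟨Cf, hCf0, hCf⟩ := exists_norm_zetaPow_le_far R hR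
  obtain ⟨Cn, hCn0, hCn⟩ := exists_norm_exp_mul_logZeta₁_le R hR
  obtain ⟨CH, hCH0, hCH⟩ := hankelLoop_sub_le (R + N)
  obtain ⟨K, hK0, hK⟩ := norm_keyhole_sub_sum_le R N hN
  obtain ⟨hρ, hρw, hρ4⟩ := rho_pos hσ₁
  set ρ : ℝ := rho σ₁ with hρdef
  set c : ℝ := zfrConst with hcdef
  have hc : 0 < c := zfrConst_pos
  set κ : ℝ := 2 * R + N + 1 with hκdef
  have hκ1 : 1 ≤ κ := by rw [hκdef]; have : (0:ℝ) ≤ N := Nat.cast_nonneg N; linarith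
  have hκ0 : 0 < κ := by linarith
  -- the eventual conditions in `L`
  set ε : ℝ := c / (κ * (κ + 1)) with hεdef
  have hε : 0 < ε := by positivity
  set A : ℝ := max (2 * c / (κ * (1 - σ₁)) + 1) (16 * c / (κ * ρ)) with hAdef
  set L₁ : ℝ := max 3 (8 / ρ) with hL₁def
  obtain ⟨L₀, hL₀⟩ := Filter.eventually_atTop.1 (eventually_params ε hε A L₁)
  -- the constant
  set M : ℝ := Cn * B * 2 with hMdef
  set Ctot : ℝ := (2 * π)⁻¹ * (
      2 * (Real.exp 1 * |B|) +
      2 * (2 * (Real.exp 1 * (Cf * ((κ + 1)) ^ R) * |B|)) +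
      2 * (4 * π * ((Cf * (κ + 1) ^ R) * |B|)) +
      2 * (4 * (Cn * Real.exp (π * R) * |B| * (((κ + 1) / (2 * c)) ^ R + 2 ^ R))) +
      N * (|M| * (2 / ρ) ^ N * CH) +
      K * (|M| / ρ ^ N)) with hCtot
  refine ⟨Ctot, Real.exp (max L₀ 3), by
    have : (0:ℝ) < max L₀ 3 := lt_max_of_lt_right (by norm_num)
    calc (1:ℝ) = Real.exp 0 := Real.exp_zero.symm
      _ < Real.exp (max L₀ 3) := Real.exp_lt_exp.2 this, fun z a G h x hx ↦ ?_⟩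
  -- unpack the conditions at this `x`
  set L : ℝ := Real.log x with hLdef
  have hx3 : Real.exp (max L₀ 3) ≤ x := hx
  have hx0 : 0 < x := (Real.exp_pos _).trans_le hx3
  have hLge : max L₀ 3 ≤ L := by
    rw [hLdef, ← Real.log_exp (max L₀ 3)]
    exact Real.log_le_log (Real.exp_pos _) hx3
  have hLL₀ : L₀ ≤ L := (le_max_left _ _).trans hLge
  obtain ⟨hLL₁, hAL, hεL⟩ := hL₀ L hLL₀
  have hL3 : 3 ≤ L := (le_max_left _ _).trans hLL₁
  have hLρ : 8 / ρ ≤ L := (le_max_right _ _).trans hLL₁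
  have hL0 : 0 < L := by linarith
  have hL1 : 1 ≤ L := by linarith
  have hx1 : 1 < x := by
    have : Real.exp 0 < x := (Real.exp_lt_exp.2 (by
      have : (0:ℝ) < max L₀ 3 := lt_max_of_lt_right (by norm_num); exact this)).trans_le hx3
    simpa using this
  obtain ⟨hlogT1, hlogT2, hlogL1, hT3⟩ := log_rpow_add_three_bounds hL3 hκ1
  set T : ℝ := L ^ κ with hTdef
  have hT1 : 1 ≤ T := by linarith
  have hT0 : 0 < T := by linarith
  have hlogT0 : 0 < Real.log (T + 3) := Real.log_pos (by linarith)
  have hlogL0 : 0 < Real.log L := by linarith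
  -- `1 - b`, `β`
  set b : ℝ := leftAbscissa T with hbdef
  have h1b : 1 - b = 2 * c / Real.log (T + 3) := (one_sub_leftAbscissa hT0.le).1
  have h1bpos : 0 < 1 - b := by rw [h1b]; positivity
  have h1b_le : 1 - b ≤ 2 * c / (κ * Real.log L) := by
    rw [h1b]; exact div_le_div_of_nonneg_left (by linarith) (by positivity) hlogT1
  have h1b_ge : 2 * c / ((κ + 1) * Real.log L) ≤ 1 - b := by
    rw [h1b]; exact div_le_div_of_nonneg_left (by linarith) hlogT0 hlogT2
  set β : ℝ := L * (1 - b) with hβdef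
  -- from `(log L)^2 ≤ ε L`: `κ (κ+1) (log L)^2 ≤ c L`
  have hkey : κ * (κ + 1) * Real.log L ^ 2 ≤ c * L := by
    have := mul_le_mul_of_nonneg_left hεL (by positivity : 0 ≤ κ * (κ + 1))
    rw [hεdef] at this
    calc κ * (κ + 1) * Real.log L ^ 2 ≤ κ * (κ + 1) * (c / (κ * (κ + 1)) * L) := this
      _ = c * L := by field_simp
  -- `β ≥ 2 κ log L ≥ 1`
  have hβge : 2 * κ * Real.log L ≤ β := by
    rw [hβdef]
    have h1 : L * (2 * c / ((κ + 1) * Real.log L)) ≤ L * (1 - b) :=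
      mul_le_mul_of_nonneg_left h1b_ge hL0.le
    refine le_trans ?_ h1
    rw [show L * (2 * c / ((κ + 1) * Real.log L)) = 2 * (c * L) / ((κ + 1) * Real.log L) by ring]
    rw [le_div_iff₀ (by positivity)]
    calc 2 * κ * Real.log L * ((κ + 1) * Real.log L) = 2 * (κ * (κ + 1) * Real.log L ^ 2) := by ring
      _ ≤ 2 * (c * L) := by linarith [hkey]
  have hβ1 : 1 ≤ β := by
    have : (1:ℝ) ≤ κ * Real.log L := one_le_mul_of_one_le_of_one_le hκ1 hlogL1
    linarith
  -- `σ₁ < b`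
  have hA1 : 2 * c / (κ * (1 - σ₁)) + 1 ≤ Real.log L := (le_max_left _ _).trans hAL
  have hA2 : 16 * c / (κ * ρ) ≤ Real.log L := (le_max_right _ _).trans hAL
  have hσ₁b : σ₁ < b := by
    have h1 : 2 * c / (κ * Real.log L) < 1 - σ₁ := by
      rw [div_lt_iff₀ (by positivity)]
      have h2 : 2 * c / (κ * (1 - σ₁)) < Real.log L := by linarith
      have h1σ : 0 < 1 - σ₁ := by linarith
      rw [div_lt_iff₀ (by positivity)] at h2
      calc 2 * c < Real.log L * (κ * (1 - σ₁)) := h2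
        _ = (1 - σ₁) * (κ * Real.log L) := by ring
    linarith
  -- the fit `(β + 1)/L ≤ ρ/4`
  have hfit : (β + 1) / L ≤ ρ / 4 := by
    rw [hβdef, show (L * (1 - b) + 1) / L = (1 - b) + 1 / L by field_simp]
    have h1 : 1 - b ≤ ρ / 8 := by
      refine h1b_le.trans ?_
      rw [div_le_iff₀ (by positivity)]
      rw [div_le_iff₀ (by positivity)] at hA2
      have : Real.log L * (κ * ρ) = 8 * (ρ / 8 * (κ * Real.log L)) := by ring
      linarith
    have h2 : 1 / L ≤ ρ / 8 := by
      rw [div_le_iff₀ hL0]; rw [div_le_iff₀ hρ] at hLρ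
      have : L * ρ = 8 * (ρ / 8 * L) := by ring
      linarith
    linarith
  -- apply the fixed-`x` estimate
  have hmain := norm_rieszMean_sub_le h hσ₁ (N := N) hCf hCn ⟨hCH0, hCH⟩ ⟨hK0, hK⟩ hx1 hL1 hT1
    hσ₁b hβ1 hfit
  -- now bound each term by a constant times `x² L^{-R-N-1}` or `x² L^{Re z - N - 1}`
  have hB0 : 0 ≤ B := (norm_nonneg _).trans (h.norm_G_le 2 (by simp; linarith))
  have hBabs : B = |B| := (abs_of_nonneg hB0).symm
  have hM0 : 0 ≤ M := by positivity
  have hMabs : M = |M| := (abs_of_nonneg hM0).symm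
  have hzre : -R ≤ z.re := by linarith [neg_abs_le z.re, (abs_re_le_norm z).trans h.norm_le]
  -- powers of `L`
  have hLpow : ∀ e : ℝ, 0 < L ^ e := fun e ↦ Real.rpow_pos_of_pos hL0 e
  have hLmono : ∀ {e f : ℝ}, e ≤ f → L ^ e ≤ L ^ f := fun hef ↦ rpow_le_rpow_of_le hL1 hef
  have htarget : L ^ (-R - N - 1) ≤ L ^ (z.re - 1 - N) := hLmono (by linarith)
  have hTpow : ∀ e : ℝ, T ^ e = L ^ (κ * e) := fun e ↦ by rw [hTdef, ← Real.rpow_mul hL0.le]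
  have hexpβ : Real.exp (-β / 2) ≤ L ^ (-κ) := by
    have : Real.exp (-β / 2) ≤ Real.exp (-(κ * Real.log L)) := Real.exp_le_exp.2 (by linarith)
    refine this.trans (le_of_eq ?_)
    rw [Real.rpow_def_of_pos hL0, show Real.log L * -κ = -(κ * Real.log L) by ring]
  have hexpβ' : Real.exp (-β) ≤ L ^ (-κ) := (Real.exp_le_exp.2 (by linarith)).trans hexpβ
  have hlogTR : Real.log (T + 3) ^ R ≤ (κ + 1) ^ R * L ^ R := by
    have h1 : Real.log (T + 3) ≤ (κ + 1) * L := by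
      refine hlogT2.trans (mul_le_mul_of_nonneg_left ?_ (by linarith))
      linarith [Real.log_le_sub_one_of_pos hL0]
    calc Real.log (T + 3) ^ R ≤ ((κ + 1) * L) ^ R := Real.rpow_le_rpow hlogT0.le h1 hR
      _ = (κ + 1) ^ R * L ^ R := Real.mul_rpow (by linarith) hL0.le
  -- rewrite the estimate in terms of `L`, `b`, `β`, `ρ`, `M`
  rw [← hbdef, ← hρdef, ← hLdef, ← hβdef, ← hMdef] at hmain
  have hmain' := hmain
  clear hmain
  have hlogpow : 0 ≤ Real.log (T + 3) ^ R := (Real.rpow_pos_of_pos hlogT0 R).le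
  -- the comparison quantities
  set Q : ℝ := x ^ 2 * L ^ (-R - N - 1) with hQdef
  set Q' : ℝ := x ^ 2 * L ^ (z.re - 1 - N) with hQ'def
  have hQ0 : 0 ≤ Q := by positivity
  have hQQ' : Q ≤ Q' := mul_le_mul_of_nonneg_left htarget (by positivity)
  have hLRκ : L ^ R * L ^ (-κ) = L ^ (-R - N - 1) := by
    rw [← Real.rpow_add hL0]; congr 1; rw [hκdef]; ring
  have hb2 : 1 / 2 < b := (leftAbscissa_ge hT1).2
  have h1L : 1 / L ≤ 1 := by rw [div_le_one hL0]; exact hL1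
  -- E1: tails
  have hE1 : 2 * (Real.exp 1 * x ^ 2 * (B / (1 / L) ^ R) / T) = 2 * (Real.exp 1 * |B|) * Q := by
    rw [← hBabs, hQdef, ← hLRκ, Real.div_rpow zero_le_one hL0.le, Real.one_rpow, hTdef,
      Real.rpow_neg hL0.le]
    have : L ^ R ≠ 0 := (hLpow R).ne'
    have : L ^ κ ≠ 0 := (hLpow κ).ne'
    field_simp
  -- E2: horizontal sides
  have hE2 : 2 * ((1 + 1 / L - b) * (Real.exp 1 * x ^ 2 * (Cf * Real.log (T + 3) ^ R) * B / T ^ 2)) ≤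
      2 * (2 * (Real.exp 1 * (Cf * (κ + 1) ^ R) * |B|)) * Q := by
    have hfac : 1 + 1 / L - b ≤ 2 := by linarith
    have hb1' : b < 1 := leftAbscissa_lt_one hT0.le
    have hfac0 : 0 ≤ 1 + 1 / L - b := by linarith [show (0:ℝ) ≤ 1 / L by positivity]
    have hnum0 : 0 ≤ Real.exp 1 * x ^ 2 * (Cf * Real.log (T + 3) ^ R) * B :=
      mul_nonneg (mul_nonneg (mul_nonneg (Real.exp_pos 1).le (sq_nonneg x))
        (mul_nonneg hCf0.le hlogpow)) hB0
    have hnum : Real.exp 1 * x ^ 2 * (Cf * Real.log (T + 3) ^ R) * B ≤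
        Real.exp 1 * x ^ 2 * (Cf * ((κ + 1) ^ R * L ^ R)) * B :=
      mul_le_mul_of_nonneg_right (mul_le_mul_of_nonneg_left
        (mul_le_mul_of_nonneg_left hlogTR hCf0.le) (by positivity)) hB0
    have hT2 : T ≤ T ^ 2 := le_self_pow₀ hT1 (by norm_num)
    have hsec : Real.exp 1 * x ^ 2 * (Cf * Real.log (T + 3) ^ R) * B / T ^ 2 ≤
        Real.exp 1 * (Cf * (κ + 1) ^ R) * |B| * Q := by
      calc Real.exp 1 * x ^ 2 * (Cf * Real.log (T + 3) ^ R) * B / T ^ 2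
          ≤ Real.exp 1 * x ^ 2 * (Cf * Real.log (T + 3) ^ R) * B / T :=
            div_le_div_of_nonneg_left hnum0 hT0 hT2
        _ ≤ Real.exp 1 * x ^ 2 * (Cf * ((κ + 1) ^ R * L ^ R)) * B / T :=
            div_le_div_of_nonneg_right hnum hT0.le
        _ = Real.exp 1 * (Cf * (κ + 1) ^ R) * |B| * Q := by
            rw [← hBabs, hQdef, ← hLRκ, hTdef, Real.rpow_neg hL0.le]
            have : L ^ κ ≠ 0 := (hLpow κ).ne'
            field_simp
    have hsec0 : 0 ≤ Real.exp 1 * x ^ 2 * (Cf * Real.log (T + 3) ^ R) * B / T ^ 2 :=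
      div_nonneg hnum0 (sq_nonneg T)
    calc 2 * ((1 + 1 / L - b) * (Real.exp 1 * x ^ 2 * (Cf * Real.log (T + 3) ^ R) * B / T ^ 2))
        ≤ 2 * (2 * (Real.exp 1 * (Cf * (κ + 1) ^ R) * |B| * Q)) := by
          gcongr 2 * ?_
          exact mul_le_mul hfac hsec hsec0 (by norm_num)
      _ = _ := by ring
  -- E3: left sides far
  have hE3 : 2 * (4 * π * (x ^ 2 * Real.exp (-β) * (Cf * Real.log (T + 3) ^ R) * B)) ≤
      2 * (4 * π * ((Cf * (κ + 1) ^ R) * |B|)) * Q := by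
    have h1 : x ^ 2 * Real.exp (-β) * (Cf * Real.log (T + 3) ^ R) * B ≤
        x ^ 2 * L ^ (-κ) * (Cf * ((κ + 1) ^ R * L ^ R)) * B := by gcongr
    calc 2 * (4 * π * (x ^ 2 * Real.exp (-β) * (Cf * Real.log (T + 3) ^ R) * B))
        ≤ 2 * (4 * π * (x ^ 2 * L ^ (-κ) * (Cf * ((κ + 1) ^ R * L ^ R)) * B)) :=
          mul_le_mul_of_nonneg_left (mul_le_mul_of_nonneg_left h1 (by positivity)) (by norm_num)
      _ = 2 * (4 * π * ((Cf * (κ + 1) ^ R) * |B|)) * Q := by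
          rw [← hBabs, hQdef, ← hLRκ]; ring
  -- E4: left sides near
  have hE4 : 2 * (4 * (x ^ 2 * Real.exp (-β) * Cn * Real.exp (π * R) * B * ((1 - b) ^ (-R) + 2 ^ R))) ≤
      2 * (4 * (Cn * Real.exp (π * R) * |B| * (((κ + 1) / (2 * c)) ^ R + 2 ^ R))) * Q := by
    have hinv : (1 - b)⁻¹ ≤ (κ + 1) * L / (2 * c) := by
      have h1 : (1 - b)⁻¹ ≤ ((2 * c) / ((κ + 1) * Real.log L))⁻¹ := inv_anti₀ (by positivity) h1b_ge
      rw [inv_div] at h1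
      refine h1.trans ?_
      rw [div_le_div_iff_of_pos_right (by positivity)]
      exact mul_le_mul_of_nonneg_left (by linarith [Real.log_le_sub_one_of_pos hL0]) (by linarith)
    have hpow1 : (1 - b) ^ (-R) ≤ ((κ + 1) / (2 * c)) ^ R * L ^ R := by
      rw [Real.rpow_neg h1bpos.le, ← Real.inv_rpow h1bpos.le]
      calc (1 - b)⁻¹ ^ R ≤ ((κ + 1) * L / (2 * c)) ^ R :=
            Real.rpow_le_rpow (inv_nonneg.2 h1bpos.le) hinv hR
        _ = ((κ + 1) / (2 * c) * L) ^ R := by ring_nf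
        _ = ((κ + 1) / (2 * c)) ^ R * L ^ R := Real.mul_rpow (by positivity) hL0.le
    have hpow2 : (2 : ℝ) ^ R ≤ 2 ^ R * L ^ R :=
      le_mul_of_one_le_right (by positivity) (Real.one_le_rpow hL1 hR)
    have hsum : (1 - b) ^ (-R) + 2 ^ R ≤ (((κ + 1) / (2 * c)) ^ R + 2 ^ R) * L ^ R := by
      rw [add_mul]; exact add_le_add hpow1 hpow2
    have h1 : x ^ 2 * Real.exp (-β) * Cn * Real.exp (π * R) * B * ((1 - b) ^ (-R) + 2 ^ R) ≤
        x ^ 2 * L ^ (-κ) * Cn * Real.exp (π * R) * B * ((((κ + 1) / (2 * c)) ^ R + 2 ^ R) * L ^ R) := by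
      gcongr
    calc 2 * (4 * (x ^ 2 * Real.exp (-β) * Cn * Real.exp (π * R) * B * ((1 - b) ^ (-R) + 2 ^ R)))
        ≤ 2 * (4 * (x ^ 2 * L ^ (-κ) * Cn * Real.exp (π * R) * B *
            ((((κ + 1) / (2 * c)) ^ R + 2 ^ R) * L ^ R))) :=
          mul_le_mul_of_nonneg_left (mul_le_mul_of_nonneg_left h1 (by norm_num)) (by norm_num)
      _ = 2 * (4 * (Cn * Real.exp (π * R) * |B| * (((κ + 1) / (2 * c)) ^ R + 2 ^ R))) * Q := by
          rw [← hBabs, hQdef, ← hLRκ]; ring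
  -- E5: Hankel truncation
  have hE5 : (N : ℝ) * (M * (2 / ρ) ^ N * x ^ 2 * L ^ R * (CH * Real.exp (-β / 2))) ≤
      N * (|M| * (2 / ρ) ^ N * CH) * Q := by
    have h1 : M * (2 / ρ) ^ N * x ^ 2 * L ^ R * (CH * Real.exp (-β / 2)) ≤
        M * (2 / ρ) ^ N * x ^ 2 * L ^ R * (CH * L ^ (-κ)) :=
      mul_le_mul_of_nonneg_left (mul_le_mul_of_nonneg_left hexpβ hCH0)
        (mul_nonneg (mul_nonneg (mul_nonneg hM0 (pow_nonneg (div_nonneg zero_le_two hρ.le) N))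
          (sq_nonneg x)) (hLpow R).le)
    calc (N : ℝ) * (M * (2 / ρ) ^ N * x ^ 2 * L ^ R * (CH * Real.exp (-β / 2)))
        ≤ N * (M * (2 / ρ) ^ N * x ^ 2 * L ^ R * (CH * L ^ (-κ))) :=
          mul_le_mul_of_nonneg_left h1 (Nat.cast_nonneg N)
      _ = N * (|M| * (2 / ρ) ^ N * CH) * Q := by rw [← hMabs, hQdef, ← hLRκ]; ring
  -- E6: Taylor remainder
  have hE6 : K * (M / ρ ^ N) * x ^ 2 * L ^ (z.re - N - 1) = K * (|M| / ρ ^ N) * Q' := by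
    rw [← hMabs, hQ'def, show z.re - N - 1 = z.re - 1 - N by ring]; ring
  -- combine
  have hsumQ : 2 * (Real.exp 1 * |B|) * Q + 2 * (2 * (Real.exp 1 * (Cf * (κ + 1) ^ R) * |B|)) * Q +
      2 * (4 * π * ((Cf * (κ + 1) ^ R) * |B|)) * Q +
      2 * (4 * (Cn * Real.exp (π * R) * |B| * (((κ + 1) / (2 * c)) ^ R + 2 ^ R))) * Q +
      N * (|M| * (2 / ρ) ^ N * CH) * Q + K * (|M| / ρ ^ N) * Q' ≤
      (2 * (Real.exp 1 * |B|) + 2 * (2 * (Real.exp 1 * (Cf * (κ + 1) ^ R) * |B|)) +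
      2 * (4 * π * ((Cf * (κ + 1) ^ R) * |B|)) +
      2 * (4 * (Cn * Real.exp (π * R) * |B| * (((κ + 1) / (2 * c)) ^ R + 2 ^ R))) +
      N * (|M| * (2 / ρ) ^ N * CH) + K * (|M| / ρ ^ N)) * Q' := by
    have c1 : 0 ≤ 2 * (Real.exp 1 * |B|) := by positivity
    have c2 : 0 ≤ 2 * (2 * (Real.exp 1 * (Cf * (κ + 1) ^ R) * |B|)) := by positivity
    have c3 : 0 ≤ 2 * (4 * π * ((Cf * (κ + 1) ^ R) * |B|)) := by positivity
    have c4 : 0 ≤ 2 * (4 * (Cn * Real.exp (π * R) * |B| * (((κ + 1) / (2 * c)) ^ R + 2 ^ R))) := by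
      positivity
    have c5 : 0 ≤ (N : ℝ) * (|M| * (2 / ρ) ^ N * CH) := by positivity
    nlinarith [mul_le_mul_of_nonneg_left hQQ' c1, mul_le_mul_of_nonneg_left hQQ' c2,
      mul_le_mul_of_nonneg_left hQQ' c3, mul_le_mul_of_nonneg_left hQQ' c4,
      mul_le_mul_of_nonneg_left hQQ' c5]
  calc _ ≤ (2 * π)⁻¹ * (2 * (Real.exp 1 * |B|) * Q + 2 * (2 * (Real.exp 1 * (Cf * (κ + 1) ^ R) * |B|)) * Q +
      2 * (4 * π * ((Cf * (κ + 1) ^ R) * |B|)) * Q +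
      2 * (4 * (Cn * Real.exp (π * R) * |B| * (((κ + 1) / (2 * c)) ^ R + 2 ^ R))) * Q +
      N * (|M| * (2 / ρ) ^ N * CH) * Q + K * (|M| / ρ ^ N) * Q') := by
        refine hmain'.trans ?_
        gcongr (2 * π)⁻¹ * ?_
        rw [hE1, hE6]
        linarith [hE2, hE3, hE4, hE5]
    _ ≤ (2 * π)⁻¹ * ((2 * (Real.exp 1 * |B|) + 2 * (2 * (Real.exp 1 * (Cf * (κ + 1) ^ R) * |B|)) +
      2 * (4 * π * ((Cf * (κ + 1) ^ R) * |B|)) +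
      2 * (4 * (Cn * Real.exp (π * R) * |B| * (((κ + 1) / (2 * c)) ^ R + 2 ^ R))) +
      N * (|M| * (2 / ρ) ^ N * CH) + K * (|M| / ρ ^ N)) * Q') := by gcongr
    _ = Ctot * x ^ 2 * L ^ (z.re - 1 - N) := by rw [hCtot, hQ'def]; ring

end SelbergDelange

end Literature.NumberTheory.LFunctions
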